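import Literature.Barriers.Parity.SiegelZeroPrimePairsChiSumsPrep
import Literature.Barriers.Parity.SiegelZeroPrimePairsChiSumsMain
import Literature.NumberTheory.LFunctions.LiouvilleHarmonicSum
import Literature.NumberTheory.LFunctions.LiouvilleLogHarmonicSum
import Literature.NumberTheory.Sieve.BombieriAsymptoticSieveMertens
import HarnessLib

/-!
# Matomäki–Merikoski Lemma 2.4 (classical error term): `∑_{n ≤ N, (n,P(z))=1} χ(n) log(y/n)/n = (1 + O(𝓔)) ∏_{p<z} (1 − 1/p)⁻¹`

Sibling of `SiegelZeroPrimePairsChiSums{Prep,Sieve,Main}.lean`, which prove the structural steps of §6 of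
Matomäki–Merikoski (arXiv:2112.11412). Everything in this file is PROVED. Here the numerical bookkeeping of
§6 is carried out: the weight `w(n) = log(y/n)/n` has `|w(n)| ≤ 4 log X/n`; the rough harmonic sums are
`≪ u` (`RoughSums`); Lemma 2.2 (`MatomakiMerikoski2023_lemma22`) bounds `∑ λ(m)/m` over rough `m ≥ z`;
the sieve parameters are `θ = 1/1000`, `D = X^θ`, `β = β(A)` large; the error sums of Lemma 3.2 are
geometric (`BetaSieveErrorSums`); and the inner Liouville sums are `O(e^{−c√log})`
(`LiouvilleHarmonicSum`, `LiouvilleLogHarmonicSum`, classical zero-free region of `ζ`). The outcome is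
Lemma 2.4 of the source with its last error term `exp(−C log^{3/5−ε} X)` (Vinogradov–Korobov) replaced
by the classical `exp(−c₀ √log X)` for one absolute `c₀ > 0` — which is what the tree's zero-free
region gives, and which suffices for Corollary 1.1 (see `SiegelZeroPrimePairsFixedShift.lean`).

## References

* K. Matomäki, J. Merikoski, IMRN 2023 (arXiv:2112.11412), Lemma 2.4 and §6.
  [cite: MatomakiMerikoski2023, Lemma 2.4]
-/

noncomputable section

open Finset Real ArithmeticFunction
open scoped ArithmeticFunction.Moebius ArithmeticFunction.sigma

namespace Literature.Barriers.Parity.MatomakiMerikoski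

open Literature.NumberTheory.Sieve Literature.NumberTheory.Sieve.BetaSieve
  Literature.NumberTheory.LFunctions

/-! ### The weight `w(n) = log(y/n)/n` -/

/-- `|log(y/n)/n| ≤ 4 log X / n` for `1 ≤ y ≤ X²`, `1 ≤ n ≤ N ≤ X²`. [folklore] -/
theorem abs_log_div_div_le {X y N : ℝ} (hX : 1 ≤ X) (hy1 : 1 ≤ y) (hyX : y ≤ X ^ 2) (hNX : N ≤ X ^ 2)
    {n : ℕ} (hn : n ∈ Icc 1 ⌊N⌋₊) : |Real.log (y / n) / n| ≤ 4 * Real.log X / n := by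
  obtain ⟨hn1, hnN⟩ := mem_Icc.mp hn
  have hn0 : (0 : ℝ) < n := by exact_mod_cast hn1
  have hn1' : (1 : ℝ) ≤ n := by exact_mod_cast hn1
  have hN0 : 0 ≤ N := by
    by_contra h
    rw [not_le] at h
    have := Nat.floor_of_nonpos h.le
    rw [this] at hnN; omega
  have hnX : (n : ℝ) ≤ X ^ 2 := ((Nat.cast_le.mpr hnN).trans (Nat.floor_le hN0)).trans hNX
  have hlogX : 0 ≤ Real.log X := Real.log_nonneg hX
  have hX2 : Real.log (X ^ 2) = 2 * Real.log X := by rw [Real.log_pow]; norm_num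
  have h1 : |Real.log (y / n)| ≤ 4 * Real.log X := by
    rw [Real.log_div (by linarith) hn0.ne']
    have hy' : Real.log y ≤ 2 * Real.log X := hX2 ▸ Real.log_le_log (by linarith) hyX
    have hn' : Real.log n ≤ 2 * Real.log X := hX2 ▸ Real.log_le_log hn0 hnX
    have hy0 : 0 ≤ Real.log y := Real.log_nonneg hy1
    have hn0' : 0 ≤ Real.log n := Real.log_nonneg hn1'
    rw [abs_le]; constructor <;> linarith
  rw [abs_div, abs_of_pos hn0]
  exact div_le_div_of_nonneg_right h1 hn0.le

/-! ### Rough harmonic sums `∑_{n ≤ N, (n,P(z))=1} 1/n ≪ log N/log z` -/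

/-- **`∑_{n ≤ x rough} 1/n ≤ C₀ (log x/log z)`** for `1 < z ≤ x` (the case `k = 0` of
`RoughSums.exists_sum_rough_sigma_zero_pow_div_le'`). [cite: MatomakiMerikoski2023, §3.1 (eq:f(n)/n_average)] -/
theorem exists_sum_rough_inv_le :
    ∃ C : ℝ, 0 < C ∧ ∀ z x : ℝ, 1 < z → z ≤ x →
      ∑ d ∈ (Icc 1 ⌊x⌋₊).filter (fun n => ∀ p ∈ n.primeFactors, z ≤ ((p : ℕ) : ℝ)), (d : ℝ)⁻¹ ≤
        C * (Real.log x / Real.log z) := by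
  obtain ⟨C, hC, h⟩ := RoughSums.exists_sum_rough_sigma_zero_pow_div_le' 0
  refine ⟨C, hC, fun z x hz hzx => ?_⟩
  have := h z x hz hzx
  simp only [pow_zero, one_div, pow_one] at this
  exact this

/-- Monotonicity of the rough harmonic sum in the length. [folklore] -/
theorem sum_rough_inv_mono {z : ℝ} {M N : ℕ} (h : M ≤ N) :
    ∑ d ∈ (Icc 1 M).filter (fun n => ∀ p ∈ n.primeFactors, z ≤ ((p : ℕ) : ℝ)), (d : ℝ)⁻¹ ≤
      ∑ d ∈ (Icc 1 N).filter (fun n => ∀ p ∈ n.primeFactors, z ≤ ((p : ℕ) : ℝ)), (d : ℝ)⁻¹ :=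
  Finset.sum_le_sum_of_subset_of_nonneg (Finset.filter_subset_filter _ (Icc_subset_Icc le_rfl h))
    fun d _ _ => inv_nonneg.mpr (Nat.cast_nonneg d)

/-! ### Step 1, numerically: `χ → μ` costs `≪ log z (u⁴/(v²η^{v/2}) + vu⁵/η + u⁴/z)` -/

/-- **Step 1 of §6 with Lemma 2.2 plugged in**: for the exceptional quadratic `χ`
(`L(1 − 1/(η log q), χ) = 0`, `η ≥ 10`), `1 < z = q^v < N ≤ X²`, `X ≥ 1`, `1 ≤ y ≤ X²`, `log X = u log z`,
`u ≥ 1`: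
`|∑_{n ≤ N rough} Re χ(n) log(y/n)/n − ∑_{n ≤ N rough} μ(n) log(y/n)/n| ≤ K log z (u⁴/(v²η^{v/2}) + vu⁵/η + u⁴/z)`.
[cite: MatomakiMerikoski2023, §6 (second display)] -/
theorem step1_bound : ∃ K : ℝ, 0 < K ∧
    ∀ (q : ℕ) [NeZero q], 2 ≤ q → ∀ χ : DirichletCharacter ℂ q, χ.IsPrimitive → χ.IsQuadratic →
      ∀ η : ℝ, 10 ≤ η → χ.LFunction ((1 - 1 / (η * Real.log q) : ℝ) : ℂ) = 0 →
        ∀ z v N y X u : ℝ, 1 < z → 0 < v → z = (q : ℝ) ^ v → z < N → N ≤ X ^ 2 → 1 ≤ X → 1 ≤ y →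
          y ≤ X ^ 2 → 1 ≤ u → Real.log X = u * Real.log z →
          |∑ n ∈ (Icc 1 ⌊N⌋₊).filter (fun n => ∀ p ∈ n.primeFactors, z ≤ ((p : ℕ) : ℝ)),
              (χ n).re * (Real.log (y / n) / n) -
            ∑ n ∈ (Icc 1 ⌊N⌋₊).filter (fun n => ∀ p ∈ n.primeFactors, z ≤ ((p : ℕ) : ℝ)),
              (μ n : ℝ) * (Real.log (y / n) / n)| ≤
            K * Real.log z * (u ^ 4 / (v ^ 2 * η ^ (v / 2)) + v * u ^ 5 / η + u ^ 4 / z) := by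
  obtain ⟨C₀, hC₀, hS₀⟩ := exists_sum_rough_inv_le
  obtain ⟨K₂, hK₂, h22⟩ := MatomakiMerikoski2023_lemma22
  refine ⟨64 * C₀ * K₂, by positivity, ?_⟩
  intro q _ hq χ hprim hquad η hη hL z v N y X u hz hv hzq hzN hNX hX1 hy1 hyX hu hlogX
  have hz0 : 0 < z := by linarith
  have hlogz : 0 < Real.log z := Real.log_pos hz
  have hN1 : 1 < N := by linarith
  have hχ2 : χ ^ 2 = 1 := hquad.sq_eq_one
  -- the weight
  have hw : ∀ n ∈ Icc 1 ⌊N⌋₊, |Real.log (y / n) / n| ≤ 4 * Real.log X / n := fun n hn =>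
    abs_log_div_div_le hX1 hy1 hyX hNX hn
  have hW0 : 0 ≤ 4 * Real.log X := by have := Real.log_nonneg hX1; positivity
  have h1 := abs_sum_rough_chi_sub_sum_rough_moebius_le χ hχ2 ⌊N⌋₊ z hW0 hw
  refine h1.trans ?_
  -- `log N/log z ≤ 2u`
  have hlogN : Real.log N / Real.log z ≤ 2 * u := by
    rw [div_le_iff₀ hlogz]
    have : Real.log N ≤ Real.log (X ^ 2) := Real.log_le_log (by linarith) hNX
    rw [Real.log_pow] at this
    push_cast at this
    nlinarith
  have hlogN0 : 0 ≤ Real.log N / Real.log z := div_nonneg (Real.log_nonneg hN1.le) hlogz.le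
  -- the two factors
  have hA : ∑ k ∈ (Icc 1 ⌊N⌋₊).filter (fun n => ∀ p ∈ n.primeFactors, z ≤ ((p : ℕ) : ℝ)), (k : ℝ)⁻¹ ≤
      C₀ * (2 * u) := (hS₀ z N hz hzN.le).trans (mul_le_mul_of_nonneg_left hlogN hC₀.le)
  have hB := h22 q hq χ hprim hquad η hη hL v z N hv hzq hzN
  have hB' : ∑ m ∈ (Icc ⌈z⌉₊ ⌊N⌋₊).filter (fun m => ∀ p ∈ m.primeFactors, z ≤ ((p : ℕ) : ℝ)),
      (χ.zetaMul m).re / m ≤ K₂ * (1 / (v ^ 2 * η ^ (v / 2)) + v / η * (2 * u) + 1 / z) * (2 * u) ^ 2 := by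
    refine hB.trans ?_
    have hη0 : 0 < η := by linarith
    have ht1 : 0 ≤ 1 / (v ^ 2 * η ^ (v / 2)) := by positivity
    have ht3 : 0 ≤ 1 / z := by positivity
    have hvη : 0 ≤ v / η := by positivity
    gcongr
  have hA0 : 0 ≤ ∑ k ∈ (Icc 1 ⌊N⌋₊).filter (fun n => ∀ p ∈ n.primeFactors, z ≤ ((p : ℕ) : ℝ)), (k : ℝ)⁻¹ :=
    Finset.sum_nonneg fun k _ => inv_nonneg.mpr (Nat.cast_nonneg k)
  have hBnn : 0 ≤ ∑ m ∈ (Icc ⌈z⌉₊ ⌊N⌋₊).filter (fun m => ∀ p ∈ m.primeFactors, z ≤ ((p : ℕ) : ℝ)),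
      (χ.zetaMul m).re / m :=
    Finset.sum_nonneg fun m _ => div_nonneg
      (Literature.NumberTheory.LFunctions.SmoothEulerProduct.zetaMul_re_nonneg χ hχ2 m) (Nat.cast_nonneg m)
  have hη0 : 0 < η := by linarith
  calc 4 * Real.log X * (∑ k ∈ (Icc 1 ⌊N⌋₊).filter (fun n => ∀ p ∈ n.primeFactors, z ≤ ((p : ℕ) : ℝ)),
          (k : ℝ)⁻¹) * ∑ m ∈ (Icc ⌈z⌉₊ ⌊N⌋₊).filter (fun m => ∀ p ∈ m.primeFactors, z ≤ ((p : ℕ) : ℝ)),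
            (χ.zetaMul m).re / m
      ≤ 4 * Real.log X * (C₀ * (2 * u)) *
          (K₂ * (1 / (v ^ 2 * η ^ (v / 2)) + v / η * (2 * u) + 1 / z) * (2 * u) ^ 2) :=
        mul_le_mul (mul_le_mul_of_nonneg_left hA hW0) hB' hBnn (by positivity)
    _ = 32 * C₀ * K₂ * Real.log z * (u ^ 4 / (v ^ 2 * η ^ (v / 2)) + 2 * (v * u ^ 5 / η) + u ^ 4 / z) := by
        rw [hlogX]; field_simp; ring
    _ ≤ 64 * C₀ * K₂ * Real.log z * (u ^ 4 / (v ^ 2 * η ^ (v / 2)) + v * u ^ 5 / η + u ^ 4 / z) := by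
        have ht1 : 0 ≤ u ^ 4 / (v ^ 2 * η ^ (v / 2)) := by positivity
        have ht2 : 0 ≤ v * u ^ 5 / η := by positivity
        have ht3 : 0 ≤ u ^ 4 / z := by positivity
        have hCK : 0 ≤ C₀ * K₂ * Real.log z := by positivity
        nlinarith

/-! ### Step 2, numerically: `μ → λ_L` costs `≪ u² log z / z` -/

/-- **Step 2 of §6, numerically**: for `1 < z ≤ N ≤ X²`, `X ≥ 1`, `1 ≤ y ≤ X²`, `log X = u log z`, `u ≥ 1`:
`|∑_{n ≤ N rough} μ(n) log(y/n)/n − ∑_{n ≤ N rough} λ_L(n) log(y/n)/n| ≤ K u² log z / z`.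
[cite: MatomakiMerikoski2023, §6 (third display)] -/
theorem step2_bound : ∃ K : ℝ, 0 < K ∧
    ∀ z N y X u : ℝ, 1 < z → z ≤ N → N ≤ X ^ 2 → 1 ≤ X → 1 ≤ y → y ≤ X ^ 2 → 1 ≤ u →
      Real.log X = u * Real.log z →
      |∑ n ∈ (Icc 1 ⌊N⌋₊).filter (fun n => ∀ p ∈ n.primeFactors, z ≤ ((p : ℕ) : ℝ)),
          (μ n : ℝ) * (Real.log (y / n) / n) -
        ∑ n ∈ (Icc 1 ⌊N⌋₊).filter (fun n => ∀ p ∈ n.primeFactors, z ≤ ((p : ℕ) : ℝ)),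
          (liouville n : ℝ) * (Real.log (y / n) / n)| ≤ K * u ^ 2 * Real.log z / z := by
  obtain ⟨C₀, hC₀, hS₀⟩ := exists_sum_rough_inv_le
  refine ⟨16 * C₀, by positivity, ?_⟩
  intro z N y X u hz hzN hNX hX1 hy1 hyX hu hlogX
  have hz0 : 0 < z := by linarith
  have hlogz : 0 < Real.log z := Real.log_pos hz
  have hN1 : 1 < N := by linarith
  have hw : ∀ n ∈ Icc 1 ⌊N⌋₊, |Real.log (y / n) / n| ≤ 4 * Real.log X / n := fun n hn =>
    abs_log_div_div_le hX1 hy1 hyX hNX hn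
  have hW0 : 0 ≤ 4 * Real.log X := by have := Real.log_nonneg hX1; positivity
  refine (abs_sum_rough_moebius_sub_sum_rough_liouville_le ⌊N⌋₊ z hW0 hw).trans ?_
  have hlogN : Real.log N / Real.log z ≤ 2 * u := by
    rw [div_le_iff₀ hlogz]
    have : Real.log N ≤ Real.log (X ^ 2) := Real.log_le_log (by linarith) hNX
    rw [Real.log_pow] at this
    push_cast at this
    nlinarith
  have hS₀N : ∑ k ∈ (Icc 1 ⌊N⌋₊).filter (fun n => ∀ p ∈ n.primeFactors, z ≤ ((p : ℕ) : ℝ)), (k : ℝ)⁻¹ ≤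
      C₀ * (2 * u) := (hS₀ z N hz hzN).trans (mul_le_mul_of_nonneg_left hlogN hC₀.le)
  -- inner sums are `≤ S₀(N) ≤ 2C₀u`, the prime sum is `≤ 2/z`
  have hinner : ∀ p ∈ (Icc ⌈z⌉₊ ⌊N⌋₊).filter Nat.Prime,
      ((p : ℝ) ^ 2)⁻¹ * ∑ m ∈ (Icc 1 (⌊N⌋₊ / p ^ 2)).filter (fun n => ∀ p ∈ n.primeFactors, z ≤ ((p : ℕ) : ℝ)),
        (m : ℝ)⁻¹ ≤ ((p : ℝ) ^ 2)⁻¹ * (C₀ * (2 * u)) := by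
    intro p _
    refine mul_le_mul_of_nonneg_left ((sum_rough_inv_mono (Nat.div_le_self _ _)).trans hS₀N) (by positivity)
  have hprimes : ∑ p ∈ (Icc ⌈z⌉₊ ⌊N⌋₊).filter Nat.Prime, ((p : ℝ) ^ 2)⁻¹ ≤ 2 / z := by
    have hsub : (Icc ⌈z⌉₊ ⌊N⌋₊).filter Nat.Prime ⊆ (Nat.primesLE ⌊N⌋₊).filter (fun p : ℕ => z ≤ (p : ℝ)) := by
      intro p hp
      rw [mem_filter, mem_Icc] at hp
      rw [mem_filter, Nat.mem_primesLE]
      exact ⟨⟨hp.1.2, hp.2⟩, Nat.ceil_le.mp hp.1.1⟩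
    calc ∑ p ∈ (Icc ⌈z⌉₊ ⌊N⌋₊).filter Nat.Prime, ((p : ℝ) ^ 2)⁻¹
        ≤ ∑ p ∈ (Nat.primesLE ⌊N⌋₊).filter (fun p : ℕ => z ≤ (p : ℝ)), ((p : ℝ) ^ 2)⁻¹ :=
          Finset.sum_le_sum_of_subset_of_nonneg hsub fun p _ _ => by positivity
      _ = ∑ p ∈ (Nat.primesLE ⌊N⌋₊).filter (fun p : ℕ => z ≤ (p : ℝ)), (p : ℝ)⁻¹ ^ 2 :=
          Finset.sum_congr rfl fun p _ => by rw [inv_pow]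
      _ ≤ 2 / z := RoughSums.sum_primesGe_inv_sq_le hz N
  calc 4 * Real.log X * ∑ p ∈ (Icc ⌈z⌉₊ ⌊N⌋₊).filter Nat.Prime, ((p : ℝ) ^ 2)⁻¹ *
          ∑ m ∈ (Icc 1 (⌊N⌋₊ / p ^ 2)).filter (fun n => ∀ p ∈ n.primeFactors, z ≤ ((p : ℕ) : ℝ)), (m : ℝ)⁻¹
      ≤ 4 * Real.log X * ∑ p ∈ (Icc ⌈z⌉₊ ⌊N⌋₊).filter Nat.Prime, ((p : ℝ) ^ 2)⁻¹ * (C₀ * (2 * u)) :=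
        mul_le_mul_of_nonneg_left (Finset.sum_le_sum hinner) hW0
    _ = 4 * Real.log X * (C₀ * (2 * u)) * ∑ p ∈ (Icc ⌈z⌉₊ ⌊N⌋₊).filter Nat.Prime, ((p : ℝ) ^ 2)⁻¹ := by
        rw [← Finset.sum_mul]; ring
    _ ≤ 4 * Real.log X * (C₀ * (2 * u)) * (2 / z) := by
        refine mul_le_mul_of_nonneg_left hprimes ?_
        have := Real.log_nonneg hX1
        positivity
    _ = 16 * C₀ * u ^ 2 * Real.log z / z := by rw [hlogX]; ring

/-! ### Step 3, numerically: the sieve insertion costs `≪_A u^{2^{A+1}+1} log z · q₁^{s}/(1 − q₁)` -/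

/-- **Step 3 of §6 (sieve insertion) with (eq:f(n)/n_average) plugged in**: for `β > 1`, `1 < z ≤ N ≤ X²`,
`X ≥ 1`, `1 < D`, `β log z ≤ log D`, `1 ≤ y ≤ X²`, `log X = u log z`, `u ≥ 1`, `A : ℕ`, and
`q₁ = (β/(β−1))^{2^{A+1}}/2^A < 1`,
`|∑_{n ≤ N rough} λ_L(n) log(y/n)/n − ∑_{n ≤ N} Θ(n) λ_L(n) log(y/n)/n| ≤ K u^{2^{A+1}+1} log z · q₁^{log D/log z − β}/(1 − q₁)`
(`Θ(n) = ∑_{d ∣ (n,P(z))} μ(d)χ⁺(d)`; the `r`-th iterated remainder is `≪ (log N/log z_r)^{2^{A+1}} = ((log N/log z)(β/(β−1))^r)^{2^{A+1}}`).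
[cite: MatomakiMerikoski2023, §6 (fourth and fifth displays)] -/
theorem step3_bound (A : ℕ) : ∃ K : ℝ, 0 < K ∧
    ∀ β D z N y X u : ℝ, 1 < β → 1 < z → 1 < D → β * Real.log z ≤ Real.log D → z ≤ N → N ≤ X ^ 2 →
      1 ≤ X → 1 ≤ y → y ≤ X ^ 2 → 1 ≤ u → Real.log X = u * Real.log z →
      (β / (β - 1)) ^ (2 ^ (A + 1)) / 2 ^ A < 1 →
      |∑ n ∈ (Icc 1 ⌊N⌋₊).filter (fun n => ∀ p ∈ n.primeFactors, z ≤ ((p : ℕ) : ℝ)),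
          (liouville n : ℝ) * (Real.log (y / n) / n) -
        ∑ n ∈ Icc 1 ⌊N⌋₊, (∑ d ∈ (Nat.gcd n (∏ p ∈ (Nat.primesBelow ⌈z⌉₊).filter
          (fun p : ℕ => ¬ p ∣ 1), p)).divisors, (μ d : ℝ) * ind 1 β D d) *
            ((liouville n : ℝ) * (Real.log (y / n) / n))| ≤
        K * u ^ (2 ^ (A + 1) + 1) * Real.log z *
          (((β / (β - 1)) ^ (2 ^ (A + 1)) / 2 ^ A) ^ (Real.log D / Real.log z - β) /
            (1 - (β / (β - 1)) ^ (2 ^ (A + 1)) / 2 ^ A)) := by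
  obtain ⟨C, hC, hRS⟩ := RoughSums.exists_sum_rough_sigma_zero_pow_div_le' (A + 1)
  refine ⟨4 * 2 ^ (2 ^ (A + 1)) * C, by positivity, ?_⟩
  intro β D z N y X u hβ hz hD1 hzD hzN hNX hX1 hy1 hyX hu hlogX hq1
  set c₁ : ℕ := 2 ^ (A + 1) with hc₁
  set ρ : ℝ := β / (β - 1) with hρ
  set q₁ : ℝ := ρ ^ c₁ / 2 ^ A with hq₁def
  have hz0 : 0 < z := by linarith
  have hlogz : 0 < Real.log z := Real.log_pos hz
  have hβ1 : 0 < β - 1 := by linarith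
  have hρ1 : 1 ≤ ρ := by rw [hρ, le_div_iff₀ hβ1]; linarith
  have hρ0 : 0 < ρ := by linarith
  have hq0 : 0 < q₁ := by positivity
  have hN1 : 1 < N := by linarith
  have hw : ∀ n ∈ Icc 1 ⌊N⌋₊, |Real.log (y / n) / n| ≤ 4 * Real.log X / n := fun n hn =>
    abs_log_div_div_le hX1 hy1 hyX hNX hn
  have hW0 : 0 ≤ 4 * Real.log X := by have := Real.log_nonneg hX1; positivity
  refine (abs_sum_rough_sub_sum_sieve_le hβ hz hD1 hzD A ⌊N⌋₊ hW0 hw).trans ?_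
  have hlogN : Real.log N / Real.log z ≤ 2 * u := by
    rw [div_le_iff₀ hlogz]
    have : Real.log N ≤ Real.log (X ^ 2) := Real.log_le_log (by linarith) hNX
    rw [Real.log_pow] at this
    push_cast at this
    nlinarith
  have hlogN0 : 0 ≤ Real.log N / Real.log z := div_nonneg (Real.log_nonneg hN1.le) hlogz.le
  -- the window `z_r = z^{θ'^r}`, `θ' = 1 − 1/β`, `log z/log z_r = ρ^r`
  have hθ0 : 0 < 1 - 1 / β := by
    rw [sub_pos, div_lt_one (by linarith)]; exact hβ
  have hθ1 : 1 - 1 / β ≤ 1 := by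
    have : 0 < 1 / β := by positivity
    linarith
  have hρθ : 1 / (1 - 1 / β) = ρ := by
    rw [hρ]; field_simp
  clear_value q₁ ρ
  -- bound on the `r`-th term
  have hterm : ∀ r ∈ Icc 1 ⌊N⌋₊,
      (if Real.log D < ((r : ℕ) + β) * Real.log z then
        (∑ n ∈ (Icc 1 ⌊N⌋₊).filter (fun n => Nat.gcd n (∏ p ∈ (Nat.primesBelow
            ⌈z ^ ((1 - 1 / β) ^ r)⌉₊).filter (fun p : ℕ => ¬ p ∣ 1), p) = 1),
          ((n.divisors.card : ℝ) ^ (A + 1) / n)) / 2 ^ (A * r) else 0) ≤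
      C * (2 * u) ^ c₁ * (if Real.log D / Real.log z - β < (r : ℝ) then q₁ ^ r else 0) := by
    intro r _
    have hcond : (Real.log D < ((r : ℕ) + β) * Real.log z) ↔ (Real.log D / Real.log z - β < (r : ℝ)) := by
      rw [div_sub' (ne_of_gt hlogz), div_lt_iff₀ hlogz]
      constructor <;> intro h <;> nlinarith
    by_cases hc : Real.log D < ((r : ℕ) + β) * Real.log z
    · rw [if_pos hc, if_pos (hcond.mp hc)]
      obtain ⟨hratio, hzr1, hzrz⟩ := log_div_log_rpow_pow hz hθ0 hθ1 r
      rw [hρθ] at hratio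
      -- the rough sum at level `z_r`
      have hfilt : (Icc 1 ⌊N⌋₊).filter (fun n => Nat.gcd n (∏ p ∈ (Nat.primesBelow
            ⌈z ^ ((1 - 1 / β) ^ r)⌉₊).filter (fun p : ℕ => ¬ p ∣ 1), p) = 1) =
          (Icc 1 ⌊N⌋₊).filter (fun n => ∀ p ∈ n.primeFactors, z ^ ((1 - 1 / β) ^ r) ≤ ((p : ℕ) : ℝ)) := by
        refine Finset.filter_congr fun n hn => ?_
        have hn0 : n ≠ 0 := by have := (mem_Icc.mp hn).1; omega
        exact gcd_eq_one_iff_rough hn0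
      have hsum := hRS (z ^ ((1 - 1 / β) ^ r)) N hzr1 (hzrz.trans hzN)
      have hsum' : ∑ n ∈ (Icc 1 ⌊N⌋₊).filter (fun n => ∀ p ∈ n.primeFactors,
          z ^ ((1 - 1 / β) ^ r) ≤ ((p : ℕ) : ℝ)), ((n.divisors.card : ℝ) ^ (A + 1) / n) ≤
          C * (Real.log N / Real.log (z ^ ((1 - 1 / β) ^ r))) ^ c₁ := by
        refine (le_of_eq ?_).trans hsum
        refine Finset.sum_congr rfl fun n _ => ?_
        rw [ArithmeticFunction.sigma_zero_apply]
      -- `log N/log z_r = (log N/log z) ρ^r ≤ 2u ρ^r`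
      have hlogzr : 0 < Real.log (z ^ ((1 - 1 / β) ^ r)) := Real.log_pos hzr1
      have hsplit : Real.log N / Real.log (z ^ ((1 - 1 / β) ^ r)) =
          Real.log N / Real.log z * (Real.log z / Real.log (z ^ ((1 - 1 / β) ^ r))) := by
        field_simp
      have hrat : Real.log N / Real.log (z ^ ((1 - 1 / β) ^ r)) ≤ 2 * u * ρ ^ r := by
        rw [hsplit, hratio]
        exact mul_le_mul_of_nonneg_right hlogN (pow_nonneg hρ0.le r)
      have hrat0 : 0 ≤ Real.log N / Real.log (z ^ ((1 - 1 / β) ^ r)) :=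
        div_nonneg (Real.log_nonneg hN1.le) hlogzr.le
      rw [hfilt]
      calc (∑ n ∈ (Icc 1 ⌊N⌋₊).filter (fun n => ∀ p ∈ n.primeFactors,
              z ^ ((1 - 1 / β) ^ r) ≤ ((p : ℕ) : ℝ)), ((n.divisors.card : ℝ) ^ (A + 1) / n)) / 2 ^ (A * r)
          ≤ C * (2 * u * ρ ^ r) ^ c₁ / 2 ^ (A * r) := by
            refine div_le_div_of_nonneg_right (hsum'.trans ?_) (by positivity)
            exact mul_le_mul_of_nonneg_left (pow_le_pow_left₀ hrat0 hrat c₁) hC.le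
        _ = C * (2 * u) ^ c₁ * q₁ ^ r := by
            have h1 : (ρ ^ r) ^ c₁ = (ρ ^ c₁) ^ r := by rw [← pow_mul, mul_comm, pow_mul]
            rw [mul_pow, h1, hq₁def, div_pow, pow_mul (2 : ℝ) A r]
            ring
    · rw [if_neg hc, if_neg (fun h => hc (hcond.mpr h))]
      simp
  have hsumr := Finset.sum_le_sum hterm
  rw [← Finset.mul_sum] at hsumr
  have hgeom := sum_Icc_indicator_pow_le hq0 hq1 (Real.log D / Real.log z - β) ⌊N⌋₊
  have hlogX0 : 0 ≤ Real.log X := Real.log_nonneg hX1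
  calc 4 * Real.log X * ∑ r ∈ Icc 1 ⌊N⌋₊, (if Real.log D < ((r : ℕ) + β) * Real.log z then
          (∑ n ∈ (Icc 1 ⌊N⌋₊).filter (fun n => Nat.gcd n (∏ p ∈ (Nat.primesBelow
              ⌈z ^ ((1 - 1 / β) ^ r)⌉₊).filter (fun p : ℕ => ¬ p ∣ 1), p) = 1),
            ((n.divisors.card : ℝ) ^ (A + 1) / n)) / 2 ^ (A * r) else 0)
      ≤ 4 * Real.log X * (C * (2 * u) ^ c₁ *
          ∑ r ∈ Icc 1 ⌊N⌋₊, (if Real.log D / Real.log z - β < (r : ℝ) then q₁ ^ r else 0)) :=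
        mul_le_mul_of_nonneg_left hsumr (by positivity)
    _ ≤ 4 * Real.log X * (C * (2 * u) ^ c₁ * (q₁ ^ (Real.log D / Real.log z - β) / (1 - q₁))) := by
        refine mul_le_mul_of_nonneg_left (mul_le_mul_of_nonneg_left hgeom (by positivity)) (by positivity)
    _ = 4 * 2 ^ (2 ^ (A + 1)) * C * u ^ (2 ^ (A + 1) + 1) * Real.log z *
          (q₁ ^ (Real.log D / Real.log z - β) / (1 - q₁)) := by
        rw [hlogX, hc₁, mul_pow, pow_succ]
        ring

/-! ### The error sum `R` of Lemma 3.2 (ii): `R ≪_A q₂^{s}/(1 − q₂)` -/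

/-- **The error of Lemma 3.2 (ii) is geometric**: for `β > 1`, `1 < z`, `A : ℕ` and
`q₂ = (β/(β−1))^{4 + 2^{A+1}}/2^A < 1`,
`∑_{1 ≤ r ≤ π(z), log D < (r+β) log z} 2^{−Ar} ∏_{z_r ≤ p < z} (1 + 4/p)(1 + 2^{A+1}/p) ≤ K_A q₂^{log D/log z − β}/(1 − q₂)`
with `K_A = e^{100 + 25·2^{A+1}}` ((eq:Mertens) in product form, `log z/log z_r = (β/(β−1))^r`).
[cite: MatomakiMerikoski2023, §3.2 (end of the proof of Lemma 3.2 (ii))] -/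
theorem errorSum_ii_le (A : ℕ) {β z D : ℝ} (hβ : 1 < β) (hz : 1 < z)
    (hq : (β / (β - 1)) ^ (4 + 2 ^ (A + 1)) / 2 ^ A < 1) :
    ∑ r ∈ Icc 1 (Nat.primesBelow ⌈z⌉₊).card,
        (if Real.log D < ((r : ℕ) + β) * Real.log z then
          (∏ p ∈ (Nat.primesBelow ⌈z⌉₊).filter (fun p : ℕ => z ^ ((1 - 1 / β) ^ r) ≤ (p : ℝ)),
            ((1 + 4 / (p : ℝ)) * (1 + 2 ^ (A + 1) / (p : ℝ)))) / 2 ^ (A * r) else 0) ≤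
      Real.exp (100 + 25 * 2 ^ (A + 1)) *
        (((β / (β - 1)) ^ (4 + 2 ^ (A + 1)) / 2 ^ A) ^ (Real.log D / Real.log z - β) /
          (1 - (β / (β - 1)) ^ (4 + 2 ^ (A + 1)) / 2 ^ A)) := by
  set c₂ : ℕ := 4 + 2 ^ (A + 1) with hc₂
  set ρ : ℝ := β / (β - 1) with hρ
  set q₂ : ℝ := ρ ^ c₂ / 2 ^ A with hq₂def
  have hz0 : 0 < z := by linarith
  have hlogz : 0 < Real.log z := Real.log_pos hz
  have hβ1 : 0 < β - 1 := by linarith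
  have hρ1 : 1 ≤ ρ := by rw [hρ, le_div_iff₀ hβ1]; linarith
  have hρ0 : 0 < ρ := by linarith
  have hq0 : 0 < q₂ := by positivity
  have hθ0 : 0 < 1 - 1 / β := by
    rw [sub_pos, div_lt_one (by linarith)]; exact hβ
  have hθ1 : 1 - 1 / β ≤ 1 := by
    have : 0 < 1 / β := by positivity
    linarith
  have hρθ : 1 / (1 - 1 / β) = ρ := by
    rw [hρ]; field_simp
  clear_value q₂ ρ
  have hterm : ∀ r ∈ Icc 1 (Nat.primesBelow ⌈z⌉₊).card,
      (if Real.log D < ((r : ℕ) + β) * Real.log z then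
        (∏ p ∈ (Nat.primesBelow ⌈z⌉₊).filter (fun p : ℕ => z ^ ((1 - 1 / β) ^ r) ≤ (p : ℝ)),
          ((1 + 4 / (p : ℝ)) * (1 + 2 ^ (A + 1) / (p : ℝ)))) / 2 ^ (A * r) else 0) ≤
      Real.exp (100 + 25 * 2 ^ (A + 1)) *
        (if Real.log D / Real.log z - β < (r : ℝ) then q₂ ^ r else 0) := by
    intro r _
    have hcond : (Real.log D < ((r : ℕ) + β) * Real.log z) ↔ (Real.log D / Real.log z - β < (r : ℝ)) := by
      rw [div_sub' (ne_of_gt hlogz), div_lt_iff₀ hlogz]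
      constructor <;> intro h <;> nlinarith
    by_cases hc : Real.log D < ((r : ℕ) + β) * Real.log z
    · rw [if_pos hc, if_pos (hcond.mp hc)]
      obtain ⟨hratio, hzr1, hzrz⟩ := log_div_log_rpow_pow hz hθ0 hθ1 r
      rw [hρθ] at hratio
      have hS : ∀ p ∈ (Nat.primesBelow ⌈z⌉₊).filter (fun p : ℕ => z ^ ((1 - 1 / β) ^ r) ≤ (p : ℝ)),
          p.Prime ∧ z ^ ((1 - 1 / β) ^ r) ≤ (p : ℝ) ∧ (p : ℝ) ≤ z := by
        intro p hp
        rw [mem_filter, Nat.mem_primesBelow] at hp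
        exact ⟨hp.1.2, hp.2, (Nat.lt_ceil.mp hp.1.1).le⟩
      have h4 := prod_one_add_div_le (c := 4) (by norm_num) hzr1 hzrz hS
      have hA' := prod_one_add_div_le (c := (2 : ℝ) ^ (A + 1)) (by positivity) hzr1 hzrz hS
      rw [hratio] at h4 hA'
      have hρr0 : 0 ≤ ρ ^ r := pow_nonneg hρ0.le r
      -- convert the real powers to natural powers
      have h4' : (ρ ^ r) ^ (4 : ℝ) = (ρ ^ 4) ^ r := by
        rw [show (4 : ℝ) = ((4 : ℕ) : ℝ) by norm_num, Real.rpow_natCast, ← pow_mul, ← pow_mul, mul_comm]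
      have hA'' : (ρ ^ r) ^ ((2 : ℝ) ^ (A + 1)) = (ρ ^ (2 ^ (A + 1))) ^ r := by
        rw [show (2 : ℝ) ^ (A + 1) = ((2 ^ (A + 1) : ℕ) : ℝ) by push_cast; ring, Real.rpow_natCast,
          ← pow_mul, ← pow_mul, mul_comm]
      rw [h4'] at h4
      rw [hA''] at hA'
      rw [Finset.prod_mul_distrib]
      have hP1 : 0 ≤ ∏ p ∈ (Nat.primesBelow ⌈z⌉₊).filter (fun p : ℕ => z ^ ((1 - 1 / β) ^ r) ≤ (p : ℝ)),
          (1 + 4 / (p : ℝ)) := Finset.prod_nonneg fun p _ => by positivity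
      calc (∏ p ∈ (Nat.primesBelow ⌈z⌉₊).filter (fun p : ℕ => z ^ ((1 - 1 / β) ^ r) ≤ (p : ℝ)),
              (1 + 4 / (p : ℝ))) *
            (∏ p ∈ (Nat.primesBelow ⌈z⌉₊).filter (fun p : ℕ => z ^ ((1 - 1 / β) ^ r) ≤ (p : ℝ)),
              (1 + 2 ^ (A + 1) / (p : ℝ))) / 2 ^ (A * r)
          ≤ (Real.exp (25 * 4) * (ρ ^ 4) ^ r) * (Real.exp (25 * 2 ^ (A + 1)) * (ρ ^ (2 ^ (A + 1))) ^ r) /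
              2 ^ (A * r) := by
            refine div_le_div_of_nonneg_right (mul_le_mul h4 hA' ?_ (by positivity)) (by positivity)
            exact Finset.prod_nonneg fun p _ => by positivity
        _ = Real.exp (100 + 25 * 2 ^ (A + 1)) * q₂ ^ r := by
            rw [Real.exp_add, hq₂def, hc₂, pow_add ρ 4 (2 ^ (A + 1)), div_pow, mul_pow, pow_mul (2 : ℝ) A r]
            norm_num
            ring
    · rw [if_neg hc, if_neg (fun h => hc (hcond.mpr h))]
      simp
  refine (Finset.sum_le_sum hterm).trans ?_
  rw [← Finset.mul_sum]
  exact mul_le_mul_of_nonneg_left (sum_Icc_indicator_pow_le hq0 hq (Real.log D / Real.log z - β) _)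
    (by positivity)

/-! ### Parameters: `β = β(A)` and the absorption of powers of `u` -/

/-- **Choice of `β`**: for `A ≥ 1` there is `β ≥ 2` with `(β/(β−1))^{4 + 2^{A+1}} ≤ 2^{A/10}`
(take `β = 2 + 15(4 + 2^{A+1})/A`: `(1 + 1/(β−1))^c ≤ e^{c/(β−1)} ≤ e^{A/15} ≤ 2^{A/10}`).
[cite: MatomakiMerikoski2023, §3.2 ("if `β` is sufficiently large in terms of `A`")] -/
theorem exists_beta (A : ℕ) (hA : 1 ≤ A) :
    ∃ β : ℝ, 2 ≤ β ∧ (β / (β - 1)) ^ (4 + 2 ^ (A + 1)) ≤ (2 : ℝ) ^ ((A : ℝ) / 10) := by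
  set c : ℕ := 4 + 2 ^ (A + 1) with hc
  have hA0 : (0 : ℝ) < A := by exact_mod_cast hA
  have hc0 : (0 : ℝ) < c := by positivity
  refine ⟨2 + 15 * c / A, le_add_of_nonneg_right (by positivity), ?_⟩
  have hβ1 : (2 + 15 * (c : ℝ) / A) - 1 = 1 + 15 * c / A := by ring
  have hb0 : (0 : ℝ) < 1 + 15 * c / A := by positivity
  have hbase : (2 + 15 * (c : ℝ) / A) / ((2 + 15 * c / A) - 1) = 1 + 1 / (1 + 15 * c / A) := by
    rw [hβ1]; field_simp; ring
  rw [hbase]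
  -- `(1 + x)^c ≤ exp(cx)` with `x = 1/(1 + 15c/A) ≤ A/(15c)`
  have hx : 1 / (1 + 15 * (c : ℝ) / A) ≤ A / (15 * c) := by
    rw [div_le_div_iff₀ hb0 (by positivity)]
    have : (A : ℝ) * (1 + 15 * c / A) = A + 15 * c := by field_simp
    rw [this]
    linarith
  calc (1 + 1 / (1 + 15 * (c : ℝ) / A)) ^ c ≤ (Real.exp (1 / (1 + 15 * (c : ℝ) / A))) ^ c :=
        pow_le_pow_left₀ (by positivity) (by linarith [Real.add_one_le_exp (1 / (1 + 15 * (c : ℝ) / A))]) c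
    _ = Real.exp (c * (1 / (1 + 15 * (c : ℝ) / A))) := by rw [← Real.exp_nat_mul]
    _ ≤ Real.exp ((A : ℝ) / 15) := by
        refine Real.exp_le_exp.mpr ?_
        calc (c : ℝ) * (1 / (1 + 15 * (c : ℝ) / A)) ≤ c * (A / (15 * c)) :=
              mul_le_mul_of_nonneg_left hx hc0.le
          _ = A / 15 := by field_simp
    _ ≤ (2 : ℝ) ^ ((A : ℝ) / 10) := by
        rw [Real.rpow_def_of_pos (by norm_num : (0 : ℝ) < 2), Real.exp_le_exp]
        have h2 : (0.6931471803 : ℝ) < Real.log 2 := Real.log_two_gt_d9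
        nlinarith

/-- **Powers of `u` are absorbed by exponentials**: for `k : ℕ` and `δ > 0`,
`u^k e^{−δu} ≤ k!/δ^k` for all `u ≥ 0`. [folklore] -/
theorem pow_mul_exp_neg_le (k : ℕ) {δ : ℝ} (hδ : 0 < δ) {u : ℝ} (hu : 0 ≤ u) :
    u ^ k * Real.exp (-(δ * u)) ≤ k.factorial / δ ^ k := by
  have h := Real.pow_div_factorial_le_exp (δ * u) (mul_nonneg hδ.le hu) k
  have hfact : (0 : ℝ) < k.factorial := by exact_mod_cast Nat.factorial_pos k
  have hδk : 0 < δ ^ k := pow_pos hδ k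
  have hexp : 0 < Real.exp (δ * u) := Real.exp_pos _
  rw [mul_pow, div_le_iff₀ hfact] at h
  rw [Real.exp_neg, le_div_iff₀ hδk]
  -- `u^k e^{-δu} δ^k ≤ k!` iff `δ^k u^k ≤ k! e^{δu}`
  have : u ^ k * (Real.exp (δ * u))⁻¹ * δ ^ k = δ ^ k * u ^ k / Real.exp (δ * u) := by
    field_simp
  rw [this, div_le_iff₀ hexp]
  linarith

/-! ### Step 4, numerically: the inner Liouville sums cost `≪ (log X + 1)² e^{−c√log(N/(2D))}` -/

/-- **The main-term extraction with the Liouville bounds plugged in**: there are absolute `c > 0`, `K`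
such that for `β > 1`, `1 < z`, `1 < D ≤ X`, `β log z ≤ log D`, `4D ≤ N ≤ X²`, `X ≥ 1`, `1 ≤ y ≤ X²`,
`|∑_{n ≤ N} Θ(n) λ_L(n) log(y/n)/n − (π²/6) ∑_{d ∣ P(z)} μ(d)χ⁺(d)λ_L(d)/d| ≤ K (log X + 1)² e^{−c √log(N/(2D))}`
(`χ⁺(d) = 0` unless `d < D`; then `⌊N⌋/d ≥ N/(2D) ≥ 2` and the Liouville sums `∑_{m ≤ M} λ_L(m)/m`,
`∑_{m ≤ M} λ_L(m) log m/m + π²/6` are `O(e^{−c√log M})` by the classical zero-free region).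
[cite: MatomakiMerikoski2023, §6 (seventh display, with the classical error term)] -/
theorem step4_bound : ∃ c : ℝ, 0 < c ∧ ∃ K : ℝ, 0 < K ∧
    ∀ β D z N y X : ℝ, 1 < β → 1 < z → 1 < D → D ≤ X → β * Real.log z ≤ Real.log D → 4 * D ≤ N →
      N ≤ X ^ 2 → 1 ≤ X → 1 ≤ y → y ≤ X ^ 2 →
      |∑ n ∈ Icc 1 ⌊N⌋₊, (∑ d ∈ (Nat.gcd n (∏ p ∈ (Nat.primesBelow ⌈z⌉₊).filter
          (fun p : ℕ => ¬ p ∣ 1), p)).divisors, (μ d : ℝ) * ind 1 β D d) *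
            ((liouville n : ℝ) * (Real.log (y / n) / n)) -
        π ^ 2 / 6 * ∑ d ∈ (∏ p ∈ (Nat.primesBelow ⌈z⌉₊).filter (fun p : ℕ => ¬ p ∣ 1), p).divisors,
          (μ d : ℝ) * ind 1 β D d * (liouville d : ℝ) / d| ≤
        K * (Real.log X + 1) ^ 2 * Real.exp (-c * Real.sqrt (Real.log (N / (2 * D)))) := by
  obtain ⟨c₁, hc₁, C₁, hm⟩ := abs_sum_liouville_div_le_exp_neg_sqrt_log
  obtain ⟨c₂, hc₂, C₂, hG⟩ := abs_sum_liouville_mul_log_div_add_le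
  -- the constants are nonnegative (test at `x = 2`)
  have hC₁ : 0 ≤ C₁ := by
    have h := hm 2 le_rfl
    have he : 0 < Real.exp (-c₁ * Real.sqrt (Real.log 2)) := Real.exp_pos _
    nlinarith [abs_nonneg (∑ n ∈ Icc 1 ⌊(2 : ℝ)⌋₊, (liouville n : ℝ) / n)]
  have hC₂ : 0 ≤ C₂ := by
    have h := hG 2 le_rfl
    have he : 0 < Real.exp (-c₂ * Real.sqrt (Real.log 2)) := Real.exp_pos _
    nlinarith [abs_nonneg (∑ n ∈ Icc 1 ⌊(2 : ℝ)⌋₊, (liouville n : ℝ) * Real.log n / n + π ^ 2 / 6)]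
  set c : ℝ := min c₁ c₂ with hc
  have hc0 : 0 < c := lt_min hc₁ hc₂
  refine ⟨c, hc0, 3 * C₁ + C₂ + 1, by positivity, ?_⟩
  intro β D z N y X hβ hz hD1 hDX hzD hDN hNX hX1 hy1 hyX
  set P : ℕ := ∏ p ∈ (Nat.primesBelow ⌈z⌉₊).filter (fun p : ℕ => ¬ p ∣ 1), p with hP
  have hPsq : Squarefree P := squarefree_prod_primesBelow_filter z 1
  have hP0 : P ≠ 0 := hPsq.ne_zero
  have hy0 : 0 < y := by linarith
  have hD0 : 0 < D := by linarith
  have hN4 : 4 ≤ N := by linarith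
  have hlogX0 : 0 ≤ Real.log X := Real.log_nonneg hX1
  have hlogD : Real.log D ≤ Real.log X := Real.log_le_log hD0 hDX
  have hX2 : Real.log (X ^ 2) = 2 * Real.log X := by rw [Real.log_pow]; norm_num
  set L : ℝ := Real.log (N / (2 * D)) with hL
  have hND2 : 2 ≤ N / (2 * D) := by rw [le_div_iff₀ (by positivity)]; linarith
  have hL0 : 0 < L := Real.log_pos (by linarith)
  set B : ℝ := (3 * Real.log X * C₁ + C₂) * Real.exp (-c * Real.sqrt L) with hB
  have hB0 : 0 ≤ B := by positivity
  refine (abs_sum_sieve_liouville_log_sub_le (β := β) (D := D) hP0 ⌊N⌋₊ hy0).trans ?_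
  -- termwise bound: `ind(d)/d (⋯) ≤ [d < D] B/d`
  have hterm : ∀ d ∈ P.divisors, ind 1 β D d / d *
      (|Real.log (y / d)| * |∑ m ∈ Icc 1 (⌊N⌋₊ / d), (liouville m : ℝ) / m| +
        |∑ m ∈ Icc 1 (⌊N⌋₊ / d), (liouville m : ℝ) * Real.log m / m + π ^ 2 / 6|) ≤
      (if (d : ℝ) < D then B / d else 0) := by
    intro d hd
    have hd0 : 0 < d := Nat.pos_of_mem_divisors hd
    have hd0' : (0 : ℝ) < d := by exact_mod_cast hd0
    by_cases hpred : pred 1 β D d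
    · -- `d < D`, `M = ⌊N⌋/d ≥ N/(2D) ≥ 2`
      have hdP : d ∣ P := Nat.dvd_of_mem_divisors hd
      have hdsq : Squarefree d := hPsq.squarefree_of_dvd hdP
      have hpzd : ∀ p ∈ d.primeFactors, (p : ℝ) < z := fun p hp =>
        (mem_primeFactors_siftingProd.mp (Nat.primeFactors_mono hdP hP0 hp)).2
      have hdD : (d : ℝ) < D := lt_level_of_pred (hβ := hβ) (hD1 := hD1) (hzD := hzD) hdsq hpzd hpred
      rw [if_pos hdD, ind_of_pred hpred]
      set M : ℕ := ⌊N⌋₊ / d with hM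
      have hMlow : N / (2 * D) ≤ (M : ℝ) := by
        have h1 : (⌊N⌋₊ : ℝ) < (M : ℝ) * d + d := by
          have := Nat.lt_div_mul_add (a := ⌊N⌋₊) hd0
          exact_mod_cast this
        have h2 : N - 1 < (⌊N⌋₊ : ℝ) := by
          have := Nat.lt_floor_add_one N; linarith
        have hd1 : (1 : ℝ) ≤ d := by exact_mod_cast hd0
        -- `M > (N − 1 − d)/d ≥ N/(2d) − ...`; use `N ≥ 4D ≥ 2d + 2`
        rw [div_le_iff₀ (by positivity)]
        have hdD' : (d : ℝ) ≤ D := hdD.le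
        nlinarith [mul_le_mul_of_nonneg_left hdD' (Nat.cast_nonneg M),
          mul_le_mul_of_nonneg_left hdD' (show (0 : ℝ) ≤ 2 by norm_num)]
      have hM2 : (2 : ℝ) ≤ M := hND2.trans hMlow
      have hMpos : (0 : ℝ) < M := by linarith
      have hfl : ⌊(M : ℝ)⌋₊ = M := Nat.floor_natCast M
      have hlogM : L ≤ Real.log M := Real.log_le_log (by positivity) hMlow
      have hsqrt : Real.sqrt L ≤ Real.sqrt (Real.log M) := Real.sqrt_le_sqrt hlogM
      have hexp₁ : Real.exp (-c₁ * Real.sqrt (Real.log M)) ≤ Real.exp (-c * Real.sqrt L) := by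
        refine Real.exp_le_exp.mpr ?_
        have : c ≤ c₁ := min_le_left _ _
        nlinarith [Real.sqrt_nonneg L, Real.sqrt_nonneg (Real.log M)]
      have hexp₂ : Real.exp (-c₂ * Real.sqrt (Real.log M)) ≤ Real.exp (-c * Real.sqrt L) := by
        refine Real.exp_le_exp.mpr ?_
        have : c ≤ c₂ := min_le_right _ _
        nlinarith [Real.sqrt_nonneg L, Real.sqrt_nonneg (Real.log M)]
      have hmM : |∑ m ∈ Icc 1 M, (liouville m : ℝ) / m| ≤ C₁ * Real.exp (-c * Real.sqrt L) := by
        have := hm M hM2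
        rw [hfl] at this
        exact this.trans (mul_le_mul_of_nonneg_left hexp₁ hC₁)
      have hGM : |∑ m ∈ Icc 1 M, (liouville m : ℝ) * Real.log m / m + π ^ 2 / 6| ≤
          C₂ * Real.exp (-c * Real.sqrt L) := by
        have := hG M hM2
        rw [hfl] at this
        exact this.trans (mul_le_mul_of_nonneg_left hexp₂ hC₂)
      -- `|log(y/d)| ≤ 3 log X`
      have hlogyd : |Real.log (y / d)| ≤ 3 * Real.log X := by
        rw [Real.log_div hy0.ne' hd0'.ne']
        have hy' : Real.log y ≤ 2 * Real.log X := hX2 ▸ Real.log_le_log hy0 hyX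
        have hy0' : 0 ≤ Real.log y := Real.log_nonneg hy1
        have hd' : Real.log d ≤ Real.log X := (Real.log_le_log hd0' hdD.le).trans hlogD
        have hd0'' : 0 ≤ Real.log d := Real.log_nonneg (by exact_mod_cast hd0)
        rw [abs_le]; constructor <;> linarith
      rw [one_div, ← div_eq_inv_mul]
      refine div_le_div_of_nonneg_right ?_ hd0'.le
      calc |Real.log (y / d)| * |∑ m ∈ Icc 1 M, (liouville m : ℝ) / m| +
            |∑ m ∈ Icc 1 M, (liouville m : ℝ) * Real.log m / m + π ^ 2 / 6|
          ≤ 3 * Real.log X * (C₁ * Real.exp (-c * Real.sqrt L)) + C₂ * Real.exp (-c * Real.sqrt L) :=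
            add_le_add (mul_le_mul hlogyd hmM (abs_nonneg _) (by positivity)) hGM
        _ = B := by rw [hB]; ring
    · rw [ind_of_not_pred hpred, zero_div, zero_mul]
      split_ifs
      · positivity
      · exact le_rfl
  refine (Finset.sum_le_sum hterm).trans ?_
  -- `∑_{d ∣ P, d < D} B/d ≤ B (1 + log D)`
  rw [← Finset.sum_filter]
  have hsub : P.divisors.filter (fun d : ℕ => (d : ℝ) < D) ⊆ Icc 1 ⌊D⌋₊ := by
    intro d hd
    rw [mem_filter] at hd
    rw [mem_Icc]
    exact ⟨Nat.pos_of_mem_divisors hd.1, Nat.le_floor hd.2.le⟩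
  have hharm : ∑ d ∈ Icc 1 ⌊D⌋₊, (d : ℝ)⁻¹ ≤ 1 + Real.log D := by
    calc ∑ d ∈ Icc 1 ⌊D⌋₊, (d : ℝ)⁻¹ = ∑ d ∈ Ioc 0 ⌊D⌋₊, (d : ℝ)⁻¹ := rfl
      _ ≤ 1 + Real.log (⌊D⌋₊ : ℕ) := LiouvilleSum.sum_Ioc_inv_le_one_add_log ⌊D⌋₊
      _ ≤ 1 + Real.log D := by
          have hfl1 : (1 : ℝ) ≤ ⌊D⌋₊ := by exact_mod_cast Nat.le_floor (by exact_mod_cast hD1.le : ((1 : ℕ) : ℝ) ≤ D)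
          linarith [Real.log_le_log (by linarith) (Nat.floor_le hD0.le)]
  calc ∑ d ∈ P.divisors.filter (fun d : ℕ => (d : ℝ) < D), B / d
      ≤ ∑ d ∈ Icc 1 ⌊D⌋₊, B / d :=
        Finset.sum_le_sum_of_subset_of_nonneg hsub fun d _ _ => by positivity
    _ = B * ∑ d ∈ Icc 1 ⌊D⌋₊, (d : ℝ)⁻¹ := by rw [Finset.mul_sum]; simp_rw [div_eq_mul_inv]
    _ ≤ B * (1 + Real.log D) := mul_le_mul_of_nonneg_left hharm hB0
    _ ≤ B * (Real.log X + 1) := mul_le_mul_of_nonneg_left (by linarith) hB0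
    _ = (3 * Real.log X * C₁ + C₂) * (Real.log X + 1) * Real.exp (-c * Real.sqrt L) := by rw [hB]; ring
    _ ≤ (3 * C₁ + C₂ + 1) * (Real.log X + 1) ^ 2 * Real.exp (-c * Real.sqrt L) := by
        refine mul_le_mul_of_nonneg_right ?_ (Real.exp_pos _).le
        have h1 : 3 * Real.log X * C₁ + C₂ ≤ (3 * C₁ + C₂ + 1) * (Real.log X + 1) := by nlinarith
        calc (3 * Real.log X * C₁ + C₂) * (Real.log X + 1)
            ≤ (3 * C₁ + C₂ + 1) * (Real.log X + 1) * (Real.log X + 1) :=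
              mul_le_mul_of_nonneg_right h1 (by positivity)
          _ = (3 * C₁ + C₂ + 1) * (Real.log X + 1) ^ 2 := by ring

/-! ### The trivial bound and the size of `V(z) = ∏_{p<z} (1 − 1/p)⁻¹` -/

/-- `1 ≤ V(z)` and `log z ≤ V(z)` for `z ≥ 1` (Mertens' elementary lower bound
`log M ≤ ∏_{p < M} (1 − 1/p)⁻¹` at `M = ⌈z⌉`). [folklore] -/
theorem one_le_V_and_log_le_V {z : ℝ} (hz : 1 ≤ z) :
    1 ≤ ∏ p ∈ Nat.primesBelow ⌈z⌉₊, (1 - (p : ℝ)⁻¹)⁻¹ ∧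
      Real.log z ≤ ∏ p ∈ Nat.primesBelow ⌈z⌉₊, (1 - (p : ℝ)⁻¹)⁻¹ := by
  have hfac : ∀ p ∈ Nat.primesBelow ⌈z⌉₊, 1 ≤ (1 - (p : ℝ)⁻¹)⁻¹ := by
    intro p hp
    have hp2 : (2 : ℝ) ≤ p := by exact_mod_cast (Nat.prime_of_mem_primesBelow hp).two_le
    have h1 : (p : ℝ)⁻¹ ≤ 1 / 2 := by
      rw [inv_eq_one_div]; exact div_le_div_of_nonneg_left (by norm_num) (by norm_num) hp2
    have h2 : 0 < 1 - (p : ℝ)⁻¹ := by linarith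
    rw [one_le_inv_iff₀]
    exact ⟨h2, by linarith [inv_nonneg.mpr (by linarith : (0 : ℝ) ≤ p)]⟩
  constructor
  · calc (1 : ℝ) = ∏ _p ∈ Nat.primesBelow ⌈z⌉₊, (1 : ℝ) := Finset.prod_const_one.symm
      _ ≤ _ := Finset.prod_le_prod (fun _ _ => zero_le_one) hfac
  · have hM : 1 ≤ ⌈z⌉₊ := Nat.ceil_pos.mpr (by linarith) |> Nat.one_le_iff_ne_zero.mpr ∘ Nat.pos_iff_ne_zero.mp
    calc Real.log z ≤ Real.log (⌈z⌉₊ : ℕ) := Real.log_le_log (by linarith) (Nat.le_ceil z)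
      _ ≤ _ := BombieriSieve.log_le_prod_primesBelow_inv hM

/-- **The trivial bound** `|∑_{n ≤ N rough} Re χ(n) log(y/n)/n| ≤ K u² log z` for `1 < z`, `0 ≤ N ≤ X²`,
`X ≥ 1`, `1 ≤ y ≤ X²`, `log X = u log z`, `u ≥ 1` (`|χ| ≤ 1`, `|log(y/n)| ≤ 4 log X`, rough harmonic sum
`≤ C₀ log N/log z + 1`). [cite: MatomakiMerikoski2023, §6] -/
theorem trivial_bound : ∃ K : ℝ, 0 < K ∧ ∀ (q : ℕ) (χ : DirichletCharacter ℂ q),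
    ∀ z N y X u : ℝ, 1 < z → N ≤ X ^ 2 → 1 ≤ X → 1 ≤ y → y ≤ X ^ 2 → 1 ≤ u → Real.log X = u * Real.log z →
      |∑ n ∈ (Icc 1 ⌊N⌋₊).filter (fun n => ∀ p ∈ n.primeFactors, z ≤ ((p : ℕ) : ℝ)),
          (χ n).re * (Real.log (y / n) / n)| ≤ K * u ^ 2 * Real.log z := by
  obtain ⟨C₀, hC₀, hS₀⟩ := exists_sum_rough_inv_le
  refine ⟨4 * (2 * C₀ + 1), by positivity, ?_⟩
  intro q χ z N y X u hz hNX hX1 hy1 hyX hu hlogX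
  have hz0 : 0 < z := by linarith
  have hlogz : 0 < Real.log z := Real.log_pos hz
  have hlogX0 : 0 ≤ Real.log X := Real.log_nonneg hX1
  set R : Finset ℕ := (Icc 1 ⌊N⌋₊).filter (fun n => ∀ p ∈ n.primeFactors, z ≤ ((p : ℕ) : ℝ)) with hR
  -- `|χ(n) log(y/n)/n| ≤ 4 log X / n`
  have hterm : ∀ n ∈ R, |(χ n).re * (Real.log (y / n) / n)| ≤ 4 * Real.log X * (n : ℝ)⁻¹ := by
    intro n hn
    have hn' := (mem_filter.mp hn).1
    have hχ : |(χ n).re| ≤ 1 := (Complex.abs_re_le_norm _).trans (DirichletCharacter.norm_le_one χ n)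
    rw [abs_mul]
    calc |(χ n).re| * |Real.log (y / n) / n| ≤ 1 * (4 * Real.log X / n) :=
          mul_le_mul hχ (abs_log_div_div_le hX1 hy1 hyX hNX hn') (abs_nonneg _) zero_le_one
      _ = 4 * Real.log X * (n : ℝ)⁻¹ := by ring
  refine (abs_sum_le_sum_abs _ _).trans ((Finset.sum_le_sum hterm).trans ?_)
  rw [← Finset.mul_sum]
  -- the rough harmonic sum is `≤ 2C₀u + 1`
  have hS : ∑ n ∈ R, (n : ℝ)⁻¹ ≤ 2 * C₀ * u + 1 := by
    rcases le_or_gt z N with hzN | hzN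
    · have hN1 : 1 < N := by linarith
      have hlogN : Real.log N / Real.log z ≤ 2 * u := by
        rw [div_le_iff₀ hlogz]
        have : Real.log N ≤ Real.log (X ^ 2) := Real.log_le_log (by linarith) hNX
        rw [Real.log_pow] at this
        push_cast at this
        nlinarith
      calc ∑ n ∈ R, (n : ℝ)⁻¹ ≤ C₀ * (Real.log N / Real.log z) := hS₀ z N hz hzN
        _ ≤ C₀ * (2 * u) := mul_le_mul_of_nonneg_left hlogN hC₀.le
        _ ≤ 2 * C₀ * u + 1 := by linarith
    · -- `N < z`: only `n = 1` is rough
      have hsub : R ⊆ {1} := by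
        intro n hn
        rw [hR, mem_filter, mem_Icc] at hn
        rw [mem_singleton]
        by_contra h1
        have hn1 : 1 < n := by omega
        have hzn : z ≤ n := le_of_rough_of_one_lt hn1 hn.2
        have hnN : (n : ℝ) ≤ N := by
          have hN0 : 0 ≤ N := by
            by_contra hN
            rw [not_le] at hN
            rw [Nat.floor_of_nonpos hN.le] at hn
            omega
          exact (Nat.cast_le.mpr hn.1.2).trans (Nat.floor_le hN0)
        linarith
      calc ∑ n ∈ R, (n : ℝ)⁻¹ ≤ ∑ n ∈ ({1} : Finset ℕ), (n : ℝ)⁻¹ :=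
            Finset.sum_le_sum_of_subset_of_nonneg hsub fun n _ _ => inv_nonneg.mpr (Nat.cast_nonneg n)
        _ = 1 := by simp
        _ ≤ 2 * C₀ * u + 1 := by nlinarith
  calc 4 * Real.log X * ∑ n ∈ R, (n : ℝ)⁻¹ ≤ 4 * Real.log X * (2 * C₀ * u + 1) :=
        mul_le_mul_of_nonneg_left hS (by positivity)
    _ = 4 * (u * Real.log z) * (2 * C₀ * u + 1) := by rw [hlogX]
    _ ≤ 4 * (2 * C₀ + 1) * u ^ 2 * Real.log z := by nlinarith [mul_pos (by linarith : (0:ℝ) < u) hlogz]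

/-! ### Numerical lemmas for the choice `θ = 1/1000`, `D = X^θ` -/

/-- The geometric factor: for `A' ≥ 2`, `0 < q ≤ 2^{−0.9A'}`, `β ≥ 2`, `s = u/1000 − β ≥ 0`:
`q^s/(1 − q) ≤ 2 e^{0.7A'β} e^{−0.0006 A' u}`. [folklore] -/
theorem geometric_factor_le {A' : ℕ} (hA' : 2 ≤ A') {q β u : ℝ} (hq0 : 0 < q)
    (hq : q ≤ (2 : ℝ) ^ (-(0.9 : ℝ) * A')) (hβ : 2 ≤ β) (hs : 0 ≤ u / 1000 - β) :
    q ^ (u / 1000 - β) / (1 - q) ≤ 2 * Real.exp (0.7 * A' * β) * Real.exp (-(0.0006 * A' * u)) := by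
  have hA'2 : (2 : ℝ) ≤ A' := by exact_mod_cast hA'
  have hlog2 : (0.6931471803 : ℝ) < Real.log 2 := Real.log_two_gt_d9
  have hlog2' : Real.log 2 < (0.6931471808 : ℝ) := Real.log_two_lt_d9
  -- `q ≤ 2^{-0.9A'} ≤ 1/2`
  have hq12 : q ≤ 1 / 2 := by
    refine hq.trans ?_
    rw [Real.rpow_def_of_pos (by norm_num : (0 : ℝ) < 2), show (1 : ℝ) / 2 = Real.exp (-Real.log 2) by
      rw [Real.exp_neg, Real.exp_log (by norm_num)]; norm_num, Real.exp_le_exp]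
    nlinarith
  have h1q : 1 / (1 - q) ≤ 2 := by
    rw [div_le_iff₀ (by linarith)]; linarith
  -- `q^s ≤ (2^{-0.9A'})^s = exp(-0.9 A' s log 2) ≤ exp(0.7A'β) exp(-0.0006A'u)`
  have hqs : q ^ (u / 1000 - β) ≤ Real.exp (0.7 * A' * β) * Real.exp (-(0.0006 * A' * u)) := by
    calc q ^ (u / 1000 - β) ≤ ((2 : ℝ) ^ (-(0.9 : ℝ) * A')) ^ (u / 1000 - β) :=
          Real.rpow_le_rpow hq0.le hq hs
      _ = Real.exp (Real.log 2 * (-(0.9 : ℝ) * A') * (u / 1000 - β)) := by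
          rw [Real.rpow_def_of_pos (by norm_num : (0 : ℝ) < 2), ← Real.exp_mul]
      _ ≤ Real.exp (0.7 * A' * β + -(0.0006 * A' * u)) := by
          refine Real.exp_le_exp.mpr ?_
          have hu0 : 0 ≤ u := by linarith
          have hA'0 : (0 : ℝ) ≤ A' := by linarith
          nlinarith [mul_nonneg hA'0 hu0, mul_nonneg hA'0 (by linarith : (0 : ℝ) ≤ β)]
      _ = Real.exp (0.7 * A' * β) * Real.exp (-(0.0006 * A' * u)) := Real.exp_add _ _
  calc q ^ (u / 1000 - β) / (1 - q) = q ^ (u / 1000 - β) * (1 / (1 - q)) := by ring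
    _ ≤ (Real.exp (0.7 * A' * β) * Real.exp (-(0.0006 * A' * u))) * 2 :=
        mul_le_mul hqs h1q (div_nonneg zero_le_one (by linarith)) (by positivity)
    _ = 2 * Real.exp (0.7 * A' * β) * Real.exp (-(0.0006 * A' * u)) := by ring

/-- Splitting the decay: for `1 ≤ A'`, `A ≤ A'`, `u ≥ 0`:
`e^{−0.0006 A' u} ≤ e^{−Au/3000} e^{−0.00026 u}`. [folklore] -/
theorem exp_decay_split {A A' u : ℝ} (hA' : 1 ≤ A') (hAA' : A ≤ A') (hu : 0 ≤ u) :
    Real.exp (-(0.0006 * A' * u)) ≤ Real.exp (-A * u / 3000) * Real.exp (-(0.00026 * u)) := by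
  rw [← Real.exp_add, Real.exp_le_exp]
  nlinarith [mul_nonneg (by linarith : (0 : ℝ) ≤ A' - 1) hu, mul_nonneg (by linarith : (0 : ℝ) ≤ A' - A) hu]

/-- Absorbing `(log X + 1)²`: for `c > 0` there is `K` with
`(log X + 1)² e^{−c√L} ≤ K e^{−(c/5)√log X}` whenever `0 ≤ log X` and `0.05 log X ≤ L`. [folklore] -/
theorem log_sq_absorb {c : ℝ} (hc : 0 < c) : ∃ K : ℝ, 0 < K ∧ ∀ X L : ℝ, 0 ≤ Real.log X →
    0.05 * Real.log X ≤ L →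
      (Real.log X + 1) ^ 2 * Real.exp (-c * Real.sqrt L) ≤ K * Real.exp (-(c / 5) * Real.sqrt (Real.log X)) := by
  refine ⟨Real.exp (0.02 * c) * ((4 : ℕ).factorial / (0.02 * c) ^ 4), by positivity, ?_⟩
  intro X L hlogX hL
  set t : ℝ := Real.sqrt (Real.log X) with ht
  have ht0 : 0 ≤ t := Real.sqrt_nonneg _
  have ht2 : t ^ 2 = Real.log X := Real.sq_sqrt hlogX
  -- `√L ≥ √0.05 · t ≥ 0.22 t`
  have hsqrtL : 0.22 * t ≤ Real.sqrt L := by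
    have h1 : Real.sqrt (0.05 * Real.log X) ≤ Real.sqrt L := Real.sqrt_le_sqrt hL
    have h2 : Real.sqrt (0.05 * Real.log X) = Real.sqrt 0.05 * t := by
      rw [ht, Real.sqrt_mul (by norm_num)]
    have h3 : (0.22 : ℝ) ≤ Real.sqrt 0.05 := by
      rw [Real.le_sqrt (by norm_num) (by norm_num)]; norm_num
    rw [h2] at h1
    nlinarith
  -- `(t² + 1)² ≤ (t + 1)^4` and `(t+1)^4 e^{-0.02c(t+1)} ≤ 4!/(0.02c)^4`
  have hpoly : (Real.log X + 1) ^ 2 ≤ (t + 1) ^ 4 := by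
    rw [← ht2]; nlinarith [pow_nonneg ht0 3, pow_nonneg ht0 2]
  have habs := pow_mul_exp_neg_le 4 (by positivity : (0 : ℝ) < 0.02 * c) (by linarith : (0 : ℝ) ≤ t + 1)
  have hexp : Real.exp (-c * Real.sqrt L) ≤ Real.exp (-(0.02 * c) * (t + 1)) * Real.exp (0.02 * c) *
      Real.exp (-(c / 5) * t) := by
    rw [← Real.exp_add, ← Real.exp_add, Real.exp_le_exp]
    nlinarith
  calc (Real.log X + 1) ^ 2 * Real.exp (-c * Real.sqrt L)
      ≤ (t + 1) ^ 4 * (Real.exp (-(0.02 * c) * (t + 1)) * Real.exp (0.02 * c) * Real.exp (-(c / 5) * t)) :=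
        mul_le_mul hpoly hexp (Real.exp_pos _).le (by positivity)
    _ = ((t + 1) ^ 4 * Real.exp (-(0.02 * c * (t + 1)))) * (Real.exp (0.02 * c) * Real.exp (-(c / 5) * t)) := by
        rw [neg_mul]; ring
    _ ≤ ((4 : ℕ).factorial / (0.02 * c) ^ 4) * (Real.exp (0.02 * c) * Real.exp (-(c / 5) * t)) :=
        mul_le_mul_of_nonneg_right habs (by positivity)
    _ = Real.exp (0.02 * c) * ((4 : ℕ).factorial / (0.02 * c) ^ 4) * Real.exp (-(c / 5) * t) := by ring

/-! ### Lemma 2.4 with the classical error term: the main regime -/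

/-- Parameter facts in the main regime (`u ≥ 1000β + 10`, `z > u²`): with `D = X^{1/1000}`,
`1 < z < N`, `log X = u log z`, `1 < D ≤ X`, `β log z ≤ log D`, `4D ≤ N`, `log(N/(2D)) ≥ 0.05 log X`,
`log D/log z − β = u/1000 − β ≥ 0`, `z ≥ 4`. [folklore] -/
theorem regimeM_params {X u z N β : ℝ} (hX : 3 ≤ X) (hzX : z = X ^ (1 / u)) (hN : X ^ (1 / 10 : ℝ) ≤ N)
    (hβ2 : 2 ≤ β) (hβu : 1000 * β + 10 < u) (hzu : u ^ 2 < z) :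
    1 < z ∧ Real.log X = u * Real.log z ∧ z < N ∧ 1 < X ^ ((1 : ℝ) / 1000) ∧ X ^ ((1 : ℝ) / 1000) ≤ X ∧
      β * Real.log z ≤ Real.log (X ^ ((1 : ℝ) / 1000)) ∧ 4 * X ^ ((1 : ℝ) / 1000) ≤ N ∧
      0.05 * Real.log X ≤ Real.log (N / (2 * X ^ ((1 : ℝ) / 1000))) ∧
      Real.log (X ^ ((1 : ℝ) / 1000)) / Real.log z - β = u / 1000 - β ∧ 0 ≤ u / 1000 - β ∧ 4 ≤ z := by
  have hX1 : 1 < X := by linarith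
  have hX0 : 0 < X := by linarith
  have hlogX : 0 < Real.log X := Real.log_pos hX1
  have hu2010 : 2010 ≤ u := by linarith
  have hu0 : 0 < u := by linarith
  have hz1 : 1 < z := by rw [hzX]; exact Real.one_lt_rpow hX1 (by positivity)
  have hz0 : 0 < z := by linarith
  have hlogz : Real.log z = Real.log X / u := by rw [hzX, Real.log_rpow hX0]; ring
  have hlogXu : Real.log X = u * Real.log z := by rw [hlogz]; field_simp
  -- `log z ≥ 14`
  have hlogz14 : 14 ≤ Real.log z := by
    have hz' : Real.exp 14 ≤ z := by
      have he : Real.exp 14 ≤ 2010 ^ 2 := by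
        have h1 : Real.exp 1 < 2.7182818286 := Real.exp_one_lt_d9
        have h14 : Real.exp 14 = Real.exp 1 ^ 14 := by rw [← Real.exp_nat_mul]; norm_num
        rw [h14]
        exact (pow_le_pow_left₀ (Real.exp_pos 1).le h1.le 14).trans (by norm_num)
      have hu2 : (2010 : ℝ) ^ 2 ≤ u ^ 2 := pow_le_pow_left₀ (by norm_num) hu2010 2
      linarith
    have := Real.log_le_log (Real.exp_pos 14) hz'
    rwa [Real.log_exp] at this
  have hlogX14 : 14 * u ≤ Real.log X := by rw [hlogXu]; nlinarith
  have hzN : z < N := by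
    have : X ^ (1 / u) < X ^ (1 / 10 : ℝ) := by
      refine Real.rpow_lt_rpow_of_exponent_lt hX1 ?_
      rw [div_lt_div_iff_of_pos_left one_pos hu0 (by norm_num)]; linarith
    rw [hzX]; exact this.trans_le hN
  set D : ℝ := X ^ ((1 : ℝ) / 1000) with hD
  have hD1 : 1 < D := Real.one_lt_rpow hX1 (by norm_num)
  have hD0 : 0 < D := by linarith
  have hlogD : Real.log D = Real.log X / 1000 := by rw [hD, Real.log_rpow hX0]; ring
  have hDX : D ≤ X := by
    rw [hD]; conv_rhs => rw [← Real.rpow_one X]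
    exact Real.rpow_le_rpow_of_exponent_le hX1.le (by norm_num)
  have hs : Real.log D / Real.log z - β = u / 1000 - β := by
    rw [hlogD, hlogz]; field_simp
  have hs0 : 0 ≤ u / 1000 - β := by linarith
  have hzD : β * Real.log z ≤ Real.log D := by
    rw [hlogD, hlogXu]
    have : β ≤ u / 1000 := by linarith
    have hlz : 0 ≤ Real.log z := by linarith
    calc β * Real.log z ≤ u / 1000 * Real.log z := mul_le_mul_of_nonneg_right this hlz
      _ = u * Real.log z / 1000 := by ring
  have hexp2 : (4 : ℝ) ≤ Real.exp 2 := by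
    have h1 : (2.7182818283 : ℝ) < Real.exp 1 := Real.exp_one_gt_d9
    have h2 : Real.exp 2 = Real.exp 1 ^ 2 := by rw [← Real.exp_nat_mul]; norm_num
    rw [h2]; nlinarith
  have h4D : 4 * D ≤ N := by
    have hsplit : X ^ (1 / 10 : ℝ) = D * X ^ ((99 : ℝ) / 1000) := by
      rw [hD, ← Real.rpow_add hX0]; norm_num
    have h99 : (4 : ℝ) ≤ X ^ ((99 : ℝ) / 1000) := by
      rw [Real.rpow_def_of_pos hX0]
      refine hexp2.trans (Real.exp_le_exp.mpr ?_)
      nlinarith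
    calc 4 * D ≤ X ^ ((99 : ℝ) / 1000) * D := mul_le_mul_of_nonneg_right h99 hD0.le
      _ = X ^ (1 / 10 : ℝ) := by rw [hsplit, mul_comm]
      _ ≤ N := hN
  have hN0 : 0 < N := by linarith
  have hL : 0.05 * Real.log X ≤ Real.log (N / (2 * D)) := by
    have hlog2 : Real.log 2 < (0.6931471808 : ℝ) := Real.log_two_lt_d9
    rw [Real.log_div hN0.ne' (by positivity), Real.log_mul (by norm_num) hD0.ne', hlogD]
    have hlogN : (1 / 10 : ℝ) * Real.log X ≤ Real.log N := by
      have := Real.log_le_log (Real.rpow_pos_of_pos hX0 _) hN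
      rwa [Real.log_rpow hX0] at this
    nlinarith
  have hz4 : 4 ≤ z := by nlinarith
  exact ⟨hz1, hlogXu, hzN, hD1, hDX, hzD, h4D, hL, hs, hs0, hz4⟩

/-- The two geometric ratios `q₁ = ρ^{2^{A'+1}}/2^{A'} ≤ q₂ = ρ^{4+2^{A'+1}}/2^{A'} ≤ 2^{−0.9A'} ≤ 1/2`,
`ρ = β/(β−1)`, under the choice of `β` from `exists_beta`. [folklore] -/
theorem ratio_facts {A' : ℕ} (hA'2 : 2 ≤ A') {β : ℝ} (hβ2 : 2 ≤ β)
    (hρc : (β / (β - 1)) ^ (4 + 2 ^ (A' + 1)) ≤ (2 : ℝ) ^ ((A' : ℝ) / 10)) :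
    0 < (β / (β - 1)) ^ (2 ^ (A' + 1)) / 2 ^ A' ∧
      (β / (β - 1)) ^ (2 ^ (A' + 1)) / 2 ^ A' ≤ (2 : ℝ) ^ (-(0.9 : ℝ) * A') ∧
      (β / (β - 1)) ^ (2 ^ (A' + 1)) / 2 ^ A' < 1 ∧
      0 < (β / (β - 1)) ^ (4 + 2 ^ (A' + 1)) / 2 ^ A' ∧
      (β / (β - 1)) ^ (4 + 2 ^ (A' + 1)) / 2 ^ A' ≤ (2 : ℝ) ^ (-(0.9 : ℝ) * A') ∧
      (β / (β - 1)) ^ (4 + 2 ^ (A' + 1)) / 2 ^ A' < 1 := by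
  set ρ : ℝ := β / (β - 1) with hρ
  have hβ10 : 0 < β - 1 := by linarith
  have hρ1 : 1 ≤ ρ := by rw [hρ, le_div_iff₀ hβ10]; linarith
  have hρ0 : 0 < ρ := by linarith
  clear_value ρ
  have h2A' : (2 : ℝ) ^ ((A' : ℝ) / 10) / 2 ^ A' = (2 : ℝ) ^ (-(0.9 : ℝ) * A') := by
    rw [← Real.rpow_natCast 2 A', ← Real.rpow_sub (by norm_num : (0 : ℝ) < 2)]
    congr 1; ring
  have hq2le : ρ ^ (4 + 2 ^ (A' + 1)) / 2 ^ A' ≤ (2 : ℝ) ^ (-(0.9 : ℝ) * A') := by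
    rw [← h2A']
    exact div_le_div_of_nonneg_right hρc (by positivity)
  have hq1le : ρ ^ (2 ^ (A' + 1)) / 2 ^ A' ≤ (2 : ℝ) ^ (-(0.9 : ℝ) * A') := by
    refine le_trans (div_le_div_of_nonneg_right ?_ (by positivity)) hq2le
    exact pow_le_pow_right₀ hρ1 (by omega)
  have h2small : (2 : ℝ) ^ (-(0.9 : ℝ) * A') ≤ 1 / 2 := by
    have hA'2r : (2 : ℝ) ≤ A' := by exact_mod_cast hA'2
    rw [Real.rpow_def_of_pos (by norm_num : (0 : ℝ) < 2), show (1 : ℝ) / 2 = Real.exp (-Real.log 2) by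
      rw [Real.exp_neg, Real.exp_log (by norm_num)]; norm_num, Real.exp_le_exp]
    have hlog2 : (0.6931471803 : ℝ) < Real.log 2 := Real.log_two_gt_d9
    nlinarith
  refine ⟨by positivity, hq1le, by linarith, by positivity, hq2le, by linarith⟩

set_option maxHeartbeats 1600000 in
/-- **Lemma 2.4 in the main regime** `u > 1000β + 10`, `z > u²` (all of §6 assembled; the constant
`c₀` is one fifth of the constant of the classical Liouville bounds). [cite: MatomakiMerikoski2023, Lemma 2.4 and §6] -/
theorem lemma24_main_regime : ∃ c₀ : ℝ, 0 < c₀ ∧ ∀ (A : ℝ) (A' : ℕ) (β : ℝ), 2 ≤ A' → A ≤ A' → 2 ≤ β →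
    (β / (β - 1)) ^ (4 + 2 ^ (A' + 1)) ≤ (2 : ℝ) ^ ((A' : ℝ) / 10) → ∃ K : ℝ, 0 < K ∧
    ∀ (q : ℕ) [NeZero q], 2 ≤ q → ∀ χ : DirichletCharacter ℂ q, χ.IsPrimitive → χ.IsQuadratic →
      ∀ η : ℝ, 10 ≤ η → χ.LFunction ((1 - 1 / (η * Real.log q) : ℝ) : ℂ) = 0 →
        ∀ X u z v N y : ℝ, 3 ≤ X → z = X ^ (1 / u) → 0 < v → z = (q : ℝ) ^ v →
          X ^ (1 / 10 : ℝ) ≤ N → N ≤ X ^ 2 → 1 ≤ y → y ≤ X ^ 2 → 1000 * β + 10 < u → u ^ 2 < z →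
          |∑ n ∈ (Icc 1 ⌊N⌋₊).filter (fun n => ∀ p ∈ n.primeFactors, z ≤ ((p : ℕ) : ℝ)),
              (χ n).re * (Real.log (y / n) / n) -
            ∏ p ∈ Nat.primesBelow ⌈z⌉₊, (1 - (p : ℝ)⁻¹)⁻¹| ≤
            K * (∏ p ∈ Nat.primesBelow ⌈z⌉₊, (1 - (p : ℝ)⁻¹)⁻¹) *
              (u ^ 4 / (v ^ 2 * η ^ (v / 2)) + v * u ^ 5 / η + u ^ 4 / z + Real.exp (-A * u / 3000) +
                Real.exp (-c₀ * Real.sqrt (Real.log X))) := by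
  obtain ⟨K₁, hK₁, h1⟩ := step1_bound
  obtain ⟨K₂, hK₂, h2⟩ := step2_bound
  obtain ⟨c, hc, K₄, hK₄, h4⟩ := step4_bound
  obtain ⟨K₆, hK₆, h6⟩ := log_sq_absorb hc
  refine ⟨c / 5, by positivity, fun A A' β hA'2 hAA' hβ2 hρc => ?_⟩
  obtain ⟨K₃, hK₃, h3⟩ := step3_bound A'
  have hA'1 : (1 : ℝ) ≤ A' := by
    have h2 : (2 : ℝ) ≤ A' := by exact_mod_cast hA'2
    linarith
  have hβ1 : 1 < β := by linarith
  obtain ⟨hq10, hq1le, hq1lt, hq20, hq2le, hq2lt⟩ := ratio_facts hA'2 hβ2 hρc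
  set q₁ : ℝ := (β / (β - 1)) ^ (2 ^ (A' + 1)) / 2 ^ A' with hq₁
  set q₂ : ℝ := (β / (β - 1)) ^ (4 + 2 ^ (A' + 1)) / 2 ^ A' with hq₂
  set Eβ : ℝ := 2 * Real.exp (0.7 * A' * β) with hEβ
  set K₅ : ℝ := (2 ^ (A' + 1) + 1).factorial / (0.00026 : ℝ) ^ (2 ^ (A' + 1) + 1) with hK₅
  set KA : ℝ := Real.exp (100 + 25 * 2 ^ (A' + 1)) with hKA
  have hK₅0 : 0 < K₅ := by positivity
  have hEβ0 : 0 < Eβ := by positivity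
  have hKA0 : 0 < KA := by positivity
  set KM : ℝ := K₁ + K₂ + 8 + K₃ * Eβ * K₅ + 3 * KA * Eβ + K₄ * K₆ with hKM
  have hKM0 : 0 < KM := by positivity
  refine ⟨KM, hKM0, ?_⟩
  intro q _ hq χ hprim hquad η hη hL X u z v N y hX hzX hv hzq hN hNX hy1 hyX hβu hzu
  obtain ⟨hz1, hlogXu, hzN, hD1, hDX, hzD, h4D, hLb, hs, hs0, hz4⟩ := regimeM_params hX hzX hN hβ2 hβu hzu
  set D : ℝ := X ^ ((1 : ℝ) / 1000) with hD
  have hX1 : 1 < X := by linarith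
  have hlogX : 0 < Real.log X := Real.log_pos hX1
  have hu0 : 0 < u := by linarith
  have hu1 : 1 ≤ u := by linarith
  have hz0 : 0 < z := by linarith
  have hlogz0 : 0 < Real.log z := Real.log_pos hz1
  have hη0 : 0 < η := by linarith
  obtain ⟨hV1, hVlog⟩ := one_le_V_and_log_le_V hz1.le
  set V : ℝ := ∏ p ∈ Nat.primesBelow ⌈z⌉₊, (1 - (p : ℝ)⁻¹)⁻¹ with hV
  have hV0 : 0 ≤ V := by linarith
  set T₁ : ℝ := u ^ 4 / (v ^ 2 * η ^ (v / 2)) with hT₁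
  set T₂ : ℝ := v * u ^ 5 / η with hT₂
  set T₃ : ℝ := u ^ 4 / z with hT₃
  set T₄ : ℝ := Real.exp (-A * u / 3000) with hT₄
  set T₅ : ℝ := Real.exp (-(c / 5) * Real.sqrt (Real.log X)) with hT₅
  have hT₁0 : 0 ≤ T₁ := by positivity
  have hT₂0 : 0 ≤ T₂ := by positivity
  have hT₃0 : 0 ≤ T₃ := by positivity
  have hT₄0 : 0 ≤ T₄ := by positivity
  have hT₅0 : 0 ≤ T₅ := by positivity
  -- decay factors
  have hgeo1 := geometric_factor_le hA'2 hq10 hq1le hβ2 hs0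
  have hgeo2 := geometric_factor_le hA'2 hq20 hq2le hβ2 hs0
  have hsplitexp := exp_decay_split hA'1 hAA' hu0.le
  have hpoly := pow_mul_exp_neg_le (2 ^ (A' + 1) + 1) (by norm_num : (0 : ℝ) < 0.00026) hu0.le
  have hexp026 : Real.exp (-(0.00026 * u)) ≤ 1 := Real.exp_le_one_iff.mpr (by nlinarith)
  -- the five estimates
  have e1 := h1 q hq χ hprim hquad η hη hL z v N y X u hz1 hv hzq hzN hNX hX1.le hy1 hyX hu1 hlogXu
  have e2 := h2 z N y X u hz1 hzN.le hNX hX1.le hy1 hyX hu1 hlogXu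
  have e3 := h3 β D z N y X u hβ1 hz1 hD1 hzD hzN.le hNX hX1.le hy1 hyX hu1 hlogXu hq1lt
  have e4 := h4 β D z N y X hβ1 hz1 hD1 hDX hzD h4D hNX hX1.le hy1 hyX
  have e5 := abs_main_term_sub_le hβ1 hz1 hD1 hzD A'
  have eR := errorSum_ii_le A' (D := D) hβ1 hz1 hq2lt
  rw [hs] at e3 eR
  -- e3 consolidation
  have e3' : K₃ * u ^ (2 ^ (A' + 1) + 1) * Real.log z * (q₁ ^ (u / 1000 - β) / (1 - q₁)) ≤
      K₃ * Eβ * K₅ * V * T₄ := by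
    have hgf : q₁ ^ (u / 1000 - β) / (1 - q₁) ≤ Eβ * (T₄ * Real.exp (-(0.00026 * u))) := by
      rw [hEβ, hT₄]
      calc _ ≤ 2 * Real.exp (0.7 * A' * β) * Real.exp (-(0.0006 * A' * u)) := hgeo1
        _ ≤ 2 * Real.exp (0.7 * A' * β) * (Real.exp (-A * u / 3000) * Real.exp (-(0.00026 * u))) :=
            mul_le_mul_of_nonneg_left hsplitexp (by positivity)
    have hup : u ^ (2 ^ (A' + 1) + 1) * Real.exp (-(0.00026 * u)) ≤ K₅ := by rw [hK₅]; exact hpoly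
    have hgf0 : 0 ≤ q₁ ^ (u / 1000 - β) / (1 - q₁) := div_nonneg (Real.rpow_nonneg hq10.le _) (by linarith)
    calc K₃ * u ^ (2 ^ (A' + 1) + 1) * Real.log z * (q₁ ^ (u / 1000 - β) / (1 - q₁))
        ≤ K₃ * u ^ (2 ^ (A' + 1) + 1) * V * (Eβ * (T₄ * Real.exp (-(0.00026 * u)))) :=
          mul_le_mul (mul_le_mul_of_nonneg_left hVlog (by positivity)) hgf hgf0 (by positivity)
      _ = K₃ * Eβ * V * T₄ * (u ^ (2 ^ (A' + 1) + 1) * Real.exp (-(0.00026 * u))) := by ring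
      _ ≤ K₃ * Eβ * V * T₄ * K₅ := mul_le_mul_of_nonneg_left hup (by positivity)
      _ = K₃ * Eβ * K₅ * V * T₄ := by ring
  -- e4 consolidation
  have e4' : K₄ * (Real.log X + 1) ^ 2 * Real.exp (-c * Real.sqrt (Real.log (N / (2 * D)))) ≤
      K₄ * K₆ * V * T₅ := by
    have h := h6 X (Real.log (N / (2 * D))) hlogX.le hLb
    calc K₄ * (Real.log X + 1) ^ 2 * Real.exp (-c * Real.sqrt (Real.log (N / (2 * D))))
        = K₄ * ((Real.log X + 1) ^ 2 * Real.exp (-c * Real.sqrt (Real.log (N / (2 * D))))) := by ring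
      _ ≤ K₄ * (K₆ * T₅) := mul_le_mul_of_nonneg_left h hK₄.le
      _ ≤ K₄ * (K₆ * T₅) * V := le_mul_of_one_le_right (by positivity) hV1
      _ = K₄ * K₆ * V * T₅ := by ring
  -- e5 consolidation
  have hexp4z : Real.exp (4 / z) ≤ 3 := by
    have h1 : Real.exp (4 / z) ≤ Real.exp 1 := Real.exp_le_exp.mpr (by rw [div_le_one hz0]; exact hz4)
    have h2 : Real.exp 1 < 2.7182818286 := Real.exp_one_lt_d9
    linarith
  have hexp4z1 : Real.exp (4 / z) - 1 ≤ 8 * T₃ := by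
    have habs : |4 / z| ≤ 1 := by rw [abs_of_pos (by positivity), div_le_one hz0]; exact hz4
    have h := Real.abs_exp_sub_one_le habs
    rw [abs_of_pos (by positivity : (0 : ℝ) < 4 / z)] at h
    have h8 : 2 * (4 / z) ≤ 8 * T₃ := by
      rw [hT₃]
      have hu4 : (1 : ℝ) ≤ u ^ 4 := one_le_pow₀ hu1
      have : 2 * (4 / z) = 8 * (1 / z) := by ring
      rw [this]
      exact mul_le_mul_of_nonneg_left (div_le_div_of_nonneg_right hu4 hz0.le) (by norm_num)
    linarith [le_abs_self (Real.exp (4 / z) - 1)]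
  have hR0 : 0 ≤ ∑ r ∈ Icc 1 (Nat.primesBelow ⌈z⌉₊).card,
      (if Real.log D < ((r : ℕ) + β) * Real.log z then
        (∏ p ∈ (Nat.primesBelow ⌈z⌉₊).filter (fun p : ℕ => z ^ ((1 - 1 / β) ^ r) ≤ (p : ℝ)),
          ((1 + 4 / (p : ℝ)) * (1 + 2 ^ (A' + 1) / (p : ℝ)))) / 2 ^ (A' * r) else 0) :=
    Finset.sum_nonneg fun r _ => by
      split_ifs
      · exact div_nonneg (Finset.prod_nonneg fun p _ => by positivity) (by positivity)
      · exact le_rfl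
  have hRle : ∑ r ∈ Icc 1 (Nat.primesBelow ⌈z⌉₊).card,
      (if Real.log D < ((r : ℕ) + β) * Real.log z then
        (∏ p ∈ (Nat.primesBelow ⌈z⌉₊).filter (fun p : ℕ => z ^ ((1 - 1 / β) ^ r) ≤ (p : ℝ)),
          ((1 + 4 / (p : ℝ)) * (1 + 2 ^ (A' + 1) / (p : ℝ)))) / 2 ^ (A' * r) else 0) ≤ KA * Eβ * T₄ := by
    refine eR.trans ?_
    rw [hKA, hEβ, hT₄]
    calc Real.exp (100 + 25 * 2 ^ (A' + 1)) * (q₂ ^ (u / 1000 - β) / (1 - q₂))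
        ≤ Real.exp (100 + 25 * 2 ^ (A' + 1)) * (2 * Real.exp (0.7 * A' * β) * Real.exp (-(0.0006 * A' * u))) :=
          mul_le_mul_of_nonneg_left hgeo2 (by positivity)
      _ ≤ Real.exp (100 + 25 * 2 ^ (A' + 1)) * (2 * Real.exp (0.7 * A' * β) *
          (Real.exp (-A * u / 3000) * Real.exp (-(0.00026 * u)))) := by gcongr
      _ ≤ Real.exp (100 + 25 * 2 ^ (A' + 1)) * (2 * Real.exp (0.7 * A' * β) *
          (Real.exp (-A * u / 3000) * 1)) := by gcongr
      _ = _ := by ring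
  have e5' : V * (Real.exp (4 / z) * ∑ r ∈ Icc 1 (Nat.primesBelow ⌈z⌉₊).card,
        (if Real.log D < ((r : ℕ) + β) * Real.log z then
          (∏ p ∈ (Nat.primesBelow ⌈z⌉₊).filter (fun p : ℕ => z ^ ((1 - 1 / β) ^ r) ≤ (p : ℝ)),
            ((1 + 4 / (p : ℝ)) * (1 + 2 ^ (A' + 1) / (p : ℝ)))) / 2 ^ (A' * r) else 0) +
        (Real.exp (4 / z) - 1)) ≤ V * (3 * (KA * Eβ * T₄) + 8 * T₃) := by
    refine mul_le_mul_of_nonneg_left (add_le_add ?_ hexp4z1) hV0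
    exact mul_le_mul hexp4z hRle hR0 (by norm_num)
  -- e2, e1 consolidation
  have e2' : K₂ * u ^ 2 * Real.log z / z ≤ K₂ * V * T₃ := by
    rw [hT₃]
    have hu24 : u ^ 2 ≤ u ^ 4 := pow_le_pow_right₀ hu1 (by norm_num)
    calc K₂ * u ^ 2 * Real.log z / z = K₂ * (u ^ 2 * Real.log z) / z := by ring
      _ ≤ K₂ * (u ^ 4 * V) / z := by
          refine div_le_div_of_nonneg_right (mul_le_mul_of_nonneg_left ?_ hK₂.le) hz0.le
          exact mul_le_mul hu24 hVlog hlogz0.le (by positivity)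
      _ = K₂ * V * (u ^ 4 / z) := by ring
  have e1' : K₁ * Real.log z * (u ^ 4 / (v ^ 2 * η ^ (v / 2)) + v * u ^ 5 / η + u ^ 4 / z) ≤
      K₁ * V * (T₁ + T₂ + T₃) := by
    rw [hT₁, hT₂, hT₃]
    exact mul_le_mul_of_nonneg_right (mul_le_mul_of_nonneg_left hVlog hK₁.le) (by positivity)
  -- triangle inequality and summation
  have f1 := e1.trans e1'
  have f2 := e2.trans e2'
  have f3 := e3.trans e3'
  have f4 := e4.trans e4'
  have f5 := e5.trans e5'
  have htri : |(∑ n ∈ (Icc 1 ⌊N⌋₊).filter (fun n => ∀ p ∈ n.primeFactors, z ≤ ((p : ℕ) : ℝ)),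
      (χ n).re * (Real.log (y / n) / n)) - V| ≤
      K₁ * V * (T₁ + T₂ + T₃) + K₂ * V * T₃ + K₃ * Eβ * K₅ * V * T₄ + K₄ * K₆ * V * T₅ +
        V * (3 * (KA * Eβ * T₄) + 8 * T₃) := by
    have g1 := abs_le.mp f1
    have g2 := abs_le.mp f2
    have g3 := abs_le.mp f3
    have g4 := abs_le.mp f4
    have g5 := abs_le.mp f5
    rw [abs_le]
    constructor
    · linarith only [g1.1, g2.1, g3.1, g4.1, g5.1]
    · linarith only [g1.2, g2.2, g3.2, g4.2, g5.2]
  refine htri.trans ?_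
  have hP1 : 0 ≤ K₃ * Eβ * K₅ := by positivity
  have hP2 : 0 ≤ KA * Eβ := by positivity
  have hP3 : 0 ≤ K₄ * K₆ := by positivity
  have ha1 : K₁ ≤ KM := by rw [hKM]; linarith only [hP1, hP2, hP3, hK₂]
  have ha3 : K₁ + K₂ + 8 ≤ KM := by rw [hKM]; linarith only [hP1, hP2, hP3]
  have ha4 : K₃ * Eβ * K₅ + 3 * (KA * Eβ) ≤ KM := by rw [hKM]; linarith only [hP3, hK₁, hK₂]
  have ha5 : K₄ * K₆ ≤ KM := by rw [hKM]; linarith only [hP1, hP2, hK₁, hK₂]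
  calc K₁ * V * (T₁ + T₂ + T₃) + K₂ * V * T₃ + K₃ * Eβ * K₅ * V * T₄ + K₄ * K₆ * V * T₅ +
        V * (3 * (KA * Eβ * T₄) + 8 * T₃)
      = V * (K₁ * T₁ + K₁ * T₂ + (K₁ + K₂ + 8) * T₃ + (K₃ * Eβ * K₅ + 3 * (KA * Eβ)) * T₄ + K₄ * K₆ * T₅) := by
        ring
    _ ≤ V * (KM * T₁ + KM * T₂ + KM * T₃ + KM * T₄ + KM * T₅) := by
        refine mul_le_mul_of_nonneg_left ?_ hV0
        gcongr
    _ = KM * V * (T₁ + T₂ + T₃ + T₄ + T₅) := by ring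

/-! ### Lemma 2.4 with the classical error term -/

set_option maxHeartbeats 1600000 in
/-- **Matomäki–Merikoski 2023, Lemma 2.4 (with the classical error term).** There is an absolute
`c₀ > 0` such that for every `A ≥ 2` there is `K = K(A)` with the following property. Let `χ` be a
primitive quadratic character mod `q ≥ 2` with `L(1 − 1/(η log q), χ) = 0`, `η ≥ 10`; let `X ≥ 3`,
`u ≥ 2`, `z = X^{1/u} = q^v` (`v > 0`), `X^{1/10} ≤ N ≤ X²`, `1 ≤ y ≤ X²`. Then
`|∑_{n ≤ N, (n,P(z))=1} χ(n) log(y/n)/n − ∏_{p<z} (1 − 1/p)⁻¹|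
  ≤ K ∏_{p<z}(1 − 1/p)⁻¹ · (u⁴/(v²η^{v/2}) + vu⁵/η + u⁴/z + e^{−Au/3000} + e^{−c₀√log X})`.
This is Lemma 2.4 of the source, `= (1 + O_{A,C,ε}(𝓔)) ∏_{p<z}(1 − 1/p)⁻¹` with
`𝓔 = u⁴/(v²η^{v/2}) + vu⁵/η + u⁴/z + e^{−Au/3000} + exp(−C log^{3/5−ε} X)`, except that the last term —
which in the source comes from the Vinogradov–Korobov zero-free region via
`∑ λ_L(n)/n, ∑ λ_L(n) log n/n + π²/6 = O(exp(−C log^{3/5−ε}))` — is replaced by the classical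
`exp(−c₀√log X)` supplied by the tree's zero-free region (`LiouvilleHarmonicSum`,
`LiouvilleLogHarmonicSum`). Proof: §6 of the source (`lemma24_main_regime`: `step1_bound` (χ → μ,
Lemma 2.2), `step2_bound` (μ → λ_L), `step3_bound` (β-sieve, Lemma 3.2 (i)), `step4_bound` (inner
Liouville sums), `abs_main_term_sub_le` + `errorSum_ii_le` (Lemma 3.2 (ii), Euler product), with
`θ = 1/1000`, `D = X^θ`, `β = β(A)`); small `u` or small `z` are covered by the trivial bound.
[cite: MatomakiMerikoski2023, Lemma 2.4] -/
theorem MatomakiMerikoski2023_lemma24_classical : ∃ c₀ : ℝ, 0 < c₀ ∧ ∀ A : ℝ, 2 ≤ A → ∃ K : ℝ, 0 < K ∧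
    ∀ (q : ℕ) [NeZero q], 2 ≤ q → ∀ χ : DirichletCharacter ℂ q, χ.IsPrimitive → χ.IsQuadratic →
      ∀ η : ℝ, 10 ≤ η → χ.LFunction ((1 - 1 / (η * Real.log q) : ℝ) : ℂ) = 0 →
        ∀ X u z v N y : ℝ, 3 ≤ X → 2 ≤ u → z = X ^ (1 / u) → 0 < v → z = (q : ℝ) ^ v →
          X ^ (1 / 10 : ℝ) ≤ N → N ≤ X ^ 2 → 1 ≤ y → y ≤ X ^ 2 →
          |∑ n ∈ (Icc 1 ⌊N⌋₊).filter (fun n => ∀ p ∈ n.primeFactors, z ≤ ((p : ℕ) : ℝ)),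
              (χ n).re * (Real.log (y / n) / n) -
            ∏ p ∈ Nat.primesBelow ⌈z⌉₊, (1 - (p : ℝ)⁻¹)⁻¹| ≤
            K * (∏ p ∈ Nat.primesBelow ⌈z⌉₊, (1 - (p : ℝ)⁻¹)⁻¹) *
              (u ^ 4 / (v ^ 2 * η ^ (v / 2)) + v * u ^ 5 / η + u ^ 4 / z + Real.exp (-A * u / 3000) +
                Real.exp (-c₀ * Real.sqrt (Real.log X))) := by
  obtain ⟨c₀, hc₀, hmain⟩ := lemma24_main_regime
  obtain ⟨KT, hKT, hT⟩ := trivial_bound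
  refine ⟨c₀, hc₀, fun A hA => ?_⟩
  set A' : ℕ := ⌈A⌉₊ with hA'def
  have hAA' : A ≤ (A' : ℝ) := Nat.le_ceil A
  have hA'2 : 2 ≤ A' := by
    have : (2 : ℝ) ≤ (A' : ℝ) := hA.trans hAA'
    exact_mod_cast this
  obtain ⟨β, hβ2, hρc⟩ := exists_beta A' (by omega)
  obtain ⟨KM, hKM, hMreg⟩ := hmain A A' β hA'2 hAA' hβ2 hρc
  set U₀ : ℝ := 1000 * β + 10 with hU₀
  set KTt : ℝ := (KT + 1) * (U₀ ^ 2 * Real.exp (A * U₀ / 3000) + 1) with hKTt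
  have hKTt1 : KT + 1 ≤ KTt := by
    rw [hKTt]
    have : 1 ≤ U₀ ^ 2 * Real.exp (A * U₀ / 3000) + 1 := by
      have : 0 ≤ U₀ ^ 2 * Real.exp (A * U₀ / 3000) := by positivity
      linarith
    nlinarith
  refine ⟨KTt + KM, by positivity, ?_⟩
  intro q _ hq χ hprim hquad η hη hL X u z v N y hX hu hzX hv hzq hN hNX hy1 hyX
  have hX1 : 1 < X := by linarith
  have hX0 : 0 < X := by linarith
  have hu0 : 0 < u := by linarith
  have hu1 : 1 ≤ u := by linarith
  have hz1 : 1 < z := by rw [hzX]; exact Real.one_lt_rpow hX1 (by positivity)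
  have hz0 : 0 < z := by linarith
  have hlogz : Real.log z = Real.log X / u := by rw [hzX, Real.log_rpow hX0]; ring
  have hlogXu : Real.log X = u * Real.log z := by rw [hlogz]; field_simp
  have hη0 : 0 < η := by linarith
  obtain ⟨hV1, hVlog⟩ := one_le_V_and_log_le_V hz1.le
  set V : ℝ := ∏ p ∈ Nat.primesBelow ⌈z⌉₊, (1 - (p : ℝ)⁻¹)⁻¹ with hV
  set G : ℝ := ∑ n ∈ (Icc 1 ⌊N⌋₊).filter (fun n => ∀ p ∈ n.primeFactors, z ≤ ((p : ℕ) : ℝ)),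
    (χ n).re * (Real.log (y / n) / n) with hG
  set E : ℝ := u ^ 4 / (v ^ 2 * η ^ (v / 2)) + v * u ^ 5 / η + u ^ 4 / z + Real.exp (-A * u / 3000) +
    Real.exp (-c₀ * Real.sqrt (Real.log X)) with hE
  have hV0 : 0 ≤ V := by linarith
  have hT30 : 0 ≤ u ^ 4 / z := by positivity
  have hT40 : 0 ≤ Real.exp (-A * u / 3000) := by positivity
  have hE0 : 0 ≤ E := by positivity
  have hE3 : u ^ 4 / z ≤ E := by
    rw [hE]
    have : 0 ≤ u ^ 4 / (v ^ 2 * η ^ (v / 2)) := by positivity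
    have : 0 ≤ v * u ^ 5 / η := by positivity
    have : 0 ≤ Real.exp (-c₀ * Real.sqrt (Real.log X)) := by positivity
    linarith
  have hE4 : Real.exp (-A * u / 3000) ≤ E := by
    rw [hE]
    have : 0 ≤ u ^ 4 / (v ^ 2 * η ^ (v / 2)) := by positivity
    have : 0 ≤ v * u ^ 5 / η := by positivity
    have : 0 ≤ Real.exp (-c₀ * Real.sqrt (Real.log X)) := by positivity
    linarith
  by_cases hM : U₀ < u ∧ u ^ 2 < z
  · -- main regime
    have h := hMreg q hq χ hprim hquad η hη hL X u z v N y hX hzX hv hzq hN hNX hy1 hyX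
      (by rw [hU₀] at hM; exact hM.1) hM.2
    refine h.trans ?_
    have hKTt0 : 0 ≤ KTt := by positivity
    have : KM ≤ KTt + KM := by linarith
    exact mul_le_mul_of_nonneg_right (mul_le_mul_of_nonneg_right this hV0) hE0
  · -- trivial regime: `|G − V| ≤ (KT + 1) u² V`
    have hGtriv : |G - V| ≤ (KT + 1) * u ^ 2 * V := by
      have h := hT q χ z N y X u hz1 hNX hX1.le hy1 hyX hu1 hlogXu
      calc |G - V| ≤ |G| + |V| := abs_sub _ _
        _ ≤ KT * u ^ 2 * Real.log z + V := by rw [abs_of_nonneg hV0]; exact add_le_add h le_rfl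
        _ ≤ KT * u ^ 2 * V + u ^ 2 * V := by
            have h1 : KT * u ^ 2 * Real.log z ≤ KT * u ^ 2 * V := mul_le_mul_of_nonneg_left hVlog (by positivity)
            have h2 : V ≤ u ^ 2 * V := le_mul_of_one_le_left hV0 (one_le_pow₀ hu1)
            linarith
        _ = (KT + 1) * u ^ 2 * V := by ring
    rw [not_and_or, not_lt, not_lt] at hM
    have hu2 : u ^ 2 ≤ (U₀ ^ 2 * Real.exp (A * U₀ / 3000) + 1) * E := by
      rcases hM with huU | hzu
      · -- `u ≤ U₀`
        have hexp : 1 ≤ Real.exp (A * U₀ / 3000) * Real.exp (-A * u / 3000) := by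
          rw [← Real.exp_add]
          refine Real.one_le_exp ?_
          have := mul_le_mul_of_nonneg_left huU (by linarith : (0 : ℝ) ≤ A)
          linarith
        have h1 : u ^ 2 ≤ U₀ ^ 2 := pow_le_pow_left₀ hu0.le huU 2
        have hpos : 0 ≤ U₀ ^ 2 * Real.exp (A * U₀ / 3000) := by positivity
        calc u ^ 2 ≤ U₀ ^ 2 * (Real.exp (A * U₀ / 3000) * Real.exp (-A * u / 3000)) :=
              h1.trans (le_mul_of_one_le_right (sq_nonneg _) hexp)
          _ = U₀ ^ 2 * Real.exp (A * U₀ / 3000) * Real.exp (-A * u / 3000) := by ring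
          _ ≤ U₀ ^ 2 * Real.exp (A * U₀ / 3000) * E := mul_le_mul_of_nonneg_left hE4 hpos
          _ ≤ (U₀ ^ 2 * Real.exp (A * U₀ / 3000) + 1) * E := by
              rw [add_mul, one_mul]; linarith
      · -- `z ≤ u²`
        have h1 : u ^ 2 ≤ u ^ 4 / z := by
          rw [le_div_iff₀ hz0]
          calc u ^ 2 * z ≤ u ^ 2 * u ^ 2 := mul_le_mul_of_nonneg_left hzu (sq_nonneg u)
            _ = u ^ 4 := by ring
        have hpos : 0 ≤ U₀ ^ 2 * Real.exp (A * U₀ / 3000) := by positivity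
        calc u ^ 2 ≤ E := h1.trans hE3
          _ ≤ (U₀ ^ 2 * Real.exp (A * U₀ / 3000) + 1) * E :=
              le_mul_of_one_le_left hE0 (by linarith)
    calc |G - V| ≤ (KT + 1) * u ^ 2 * V := hGtriv
      _ ≤ (KT + 1) * ((U₀ ^ 2 * Real.exp (A * U₀ / 3000) + 1) * E) * V := by gcongr
      _ = KTt * V * E := by rw [hKTt]; ring
      _ ≤ (KTt + KM) * V * E := by
          refine mul_le_mul_of_nonneg_right (mul_le_mul_of_nonneg_right (by linarith) hV0) hE0

end Literature.Barriers.Parity.MatomakiMerikoski
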